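import Literature.NumberTheory.EllipticCurves.FineSelmerClassGroupCriterionTorsionPointField
import HarnessLib

/-!
# Deo–Ray–Sujatha's hypothesis (c2) `Hom_G(H′_L, E[p]) = 0` from the TAUTOLOGICAL EIGENSPACE of the
# class group of `ℚ(P)`: an `S`-split eigenvalue criterion on ONE torsion-point field

Topic `NumberTheory/EllipticCurves`, sub-namespace `DeoRaySujatha2023` (the hypothesis discharged is
(c2) of [DeoRaySujatha2023] Thm. 3.8/3.9 in the VERBATIM form of the tree's named fact
`thm39_fineSelmerDual_moduleFinite_of_homTrivial_divisionField`, file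
`FineSelmerClassGroupCriterion.lean`).  THEOREM-ONLY file: no definition, no named fact, no `sorry`;
unconditional except for the corollary that takes the named fact as a hypothesis `(h : …)`.
Written by the literature seat `bsd-potss-conjA-anchor` g13 (cell `bsd-potss`, rungs K9/KT of
`BirchSwinnertonDyer`) as the kernel form of the cell's «Lemma″ / Lemma‴» (seat g7's second-stage (c2)
tests, so far a PAPER step: g8 «eigenvalue refinement, not covered»): the sibling file
`FineSelmerClassGroupCriterionTorsionPointField.lean` discharges (c2) from `p ∤ h(ℚ(P))`; this file
discharges it when `p ∣ h(ℚ(P))` but the `p`-part of `Cl(ℚ(P))` avoids — modulo the classes of the primes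
above `S` — the eigenvalue pattern `σ_a ↦ a` of the automorphisms `σ_a : P ↦ aP` of `ℚ(P)`.

## The statement (folklore refinement of the class-number lemma of the sibling file)

Let `L/F` be finite Galois inside `F̄` with `G = Gal(L/F)` of order prime to `p`, `V` a `p`-torsion
`Γ_F`-module on which `Γ_L` acts trivially whose only `Γ_F`-stable subgroups are `0` and `V`, `K ⊆ L` a
subfield and `P ∈ V ∖ 0` fixed by `Γ_K`; let `S` be a set of rational primes.  Call an additive
`μ : Cl(𝓞_K) → ℤ/p` a TAUTOLOGICAL EIGENFUNCTIONAL if `μ([σ̄ I]) = a · μ([I])` whenever `σ̄ ∈ Aut(K/F)` is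
the restriction of some `τ ∈ Γ_F` with `τ P = a P` (`a ∈ ℕ`), and `S`-SPLIT if it kills the class of every
prime of `K` above a prime of `S`.  **If every `S`-split tautological eigenfunctional on `Cl(𝓞_K)`
vanishes, then every `Γ_F`-equivariant additive `f : Cl(𝓞_L) → V` killing the classes of the primes of `L`
above `S` is zero** — i.e. (c2) `Hom_G(H′_L, V) = 0` for `V = E[p]`, `L = ℚ(E[p])`,
`S = {p} ∪ {bad primes}`.  (The sibling lemma is the case `p ∤ h_K`, where `Cl(𝓞_K) ⊗ ℤ/p = 0`.)  For
`K = ℚ(P)` with `Aut(K/ℚ) = ⟨σ₂⟩ ≅ (ℤ/5)ˣ` (the cell's (t′) rows at `p = 5`) the hypothesis reads: `2` is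
not an eigenvalue of `σ₂` on `(Cl(K) ⊗ 𝔽₅)/⟨[𝔮] : 𝔮 ∣ S⟩` — a degree-`24` computation, where the class
number of `L = ℚ(E[5])` (degree `48`/`96`) is out of reach.

Proof (formalised below).  Let `T ≤ G` be the stabiliser of the line through `P` (`t ⋆ P = a_t P`,
`⋆` = the action of `G` on `V` through lifts) — a subgroup of order prime to `p`.  The CHARACTER-WEIGHTED
average `π(v) = Σ_{t ∈ T} a_t⁻¹ (t ⋆ v)` satisfies `π(t ⋆ v) = a_t π(v)` and `π(P) = #T · P ≠ 0`; with an
`𝔽_p`-functional `λ`, `λ(π P) ≠ 0`, put `ε = λ ∘ π` (a tautological eigenfunctional on `V` with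
`ε(P) ≠ 0`) and `μ = ε ∘ f`.  Then `μ̃ = μ ∘ i_{L/K}` is an `S`-split tautological eigenfunctional on
`Cl(𝓞_K)` (equivariance of `f` and of `i_{L/K}`; a prime `𝔮 ∣ q ∈ S` of `K` extends to a product of primes
of `L` containing `q`, all killed by `f`), hence `μ̃ = 0`; as `Gal(L/K)` fixes `P`, `μ` is
`Gal(L/K)`-invariant and `#Gal(L/K) · μ = μ̃ ∘ N_{L/K} = 0` (Neukirch III (1.6)(iv), the tree's
`classGroupExtend_classGroupNorm_eq_prod`), so `μ = 0`; finally `U = {v : ε(τ v) = 0 ∀ τ}` is `Γ_F`-stable,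
contains `f(Cl_L)` and not `P`, so `U = 0` and `f = 0` by irreducibility.

## Main results

* `equivariantHom_classGroup_eq_zero_of_eigenHom_subfield` — the abstract statement above.
* `homTrivial_divisionField_of_eigenHom_subfield` — `L = ℚ(W[p])`, `V = W[p]`,
  `S = {p} ∪ {primes of bad reduction}`: hypothesis (c2) of `thm39_…_homTrivial_divisionField` VERBATIM
  (its `S`-condition included) from `p ∤ #Gal(ℚ(W[p])/ℚ)`, irreducibility, and a subfield `K ⊆ ℚ(W[p])`
  fixing `P ≠ 0` on which every `S`-split tautological eigenfunctional vanishes.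
* `thm39_of_homTrivial_of_eigenHom_stabilizerField` — Deo–Ray–Sujatha Thm. 3.9 (b) BY NAME (hypothesis
  `h` = the named fact) with (c2) replaced by that eigen-condition on `K = ℚ(P)`, the fixed field of the
  stabiliser of `P`; conclusion = statement (A) of Coates–Sujatha in the tree's `∃ γ D` form.
* (APPEND, Hecke refinement) `equivariantHom_classGroup_eq_zero_of_heckeEigenHom_subfield`,
  `homTrivial_divisionField_of_heckeEigenHom_subfield`, `thm39_of_homTrivial_of_heckeEigenHom_stabilizerField`
  — the same three statements with the eigen-hypothesis weakened: assuming `V^{Γ_K} = ℕ P` (`hVH`), the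
  vanishing is only required of the `S`-split tautological eigenfunctionals that ALSO satisfy the Hecke
  relations `μ(N_{L/K}((τ|_L) · i_{L/K}[I])) = (#Gal(L/K) · a) • μ([I])` for `τ • P = a • P + Q`, `Q` in another
  eigenline (proof: the descended functional `ε ∘ f ∘ i_{L/K}` satisfies them, because `f(i[I])` is
  `Γ_K`-fixed hence a multiple `c • P` of `P`, `ε(Q) = 0` for `Q` in an eigenline with a different
  eigenvalue of some `τ₁` scaling `P`, and `μ ∘ i ∘ N = #Gal(L/K) · μ` on classes by Neukirch III (1.6)(iv)).

## References

* S. V. Deo, A. Ray, R. Sujatha, *On the μ equals zero conjecture for fine Selmer groups in Iwasawa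
  theory*, Pure Appl. Math. Q. 19 (2023) no. 2, §3: definition of `H′_L` (p. 9), Thm. 3.8 (c2),
  Thm. 3.9 (b). [DeoRaySujatha2023]
* J. Neukirch, *Algebraic Number Theory*, Grundlehren 322 (1999), Ch. III §1 Prop. (1.6) (iv)
  (`N_{L|K}(𝔄)𝓞_L = ∏_σ σ𝔄`) and Ch. I §3 (unique factorisation of ideals). [NeukirchANT1999]
-/

noncomputable section

open scoped Classical

namespace Literature.NumberTheory.EllipticCurves.DeoRaySujatha2023

open WeierstrassCurve IsDedekindDomain NumberField Field
open Literature.NumberTheory.GaloisRepresentations Literature.NumberTheory.NumberFields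
open scoped nonZeroDivisors

/-! ### Elementary helpers -/

/-- An element killed by two coprime natural numbers is zero. [folklore] -/
private theorem eq_zero_of_nsmul_eq_zero_of_coprime' {M : Type*} [AddMonoid M] {a b : ℕ}
    (hab : a.Coprime b) {x : M} (ha : a • x = 0) (hb : b • x = 0) : x = 0 := by
  have hord : addOrderOf x ∣ 1 := by
    rw [← hab]
    exact Nat.dvd_gcd (addOrderOf_dvd_of_nsmul_eq_zero ha) (addOrderOf_dvd_of_nsmul_eq_zero hb)
  exact AddMonoid.addOrderOf_eq_one_iff.mp (Nat.dvd_one.mp hord)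

/-- Restriction `Γ_F → Gal(L/F)` to a normal subextension of `F̄/F` is onto (Mathlib
`AlgEquiv.restrictNormalHom_surjective`). [folklore] -/
private theorem absRestrictNormalHom_surjective'' {F : Type*} [Field F]
    (E : IntermediateField F (AlgebraicClosure F)) [Normal F E] :
    Function.Surjective (absRestrictNormalHom E) := fun g => by
  obtain ⟨σ, hσ⟩ := AlgEquiv.restrictNormalHom_surjective (AlgebraicClosure F) g
  exact ⟨(absoluteGaloisGroup.toAlgEquiv F).symm σ, hσ⟩

/-- **An additive map on ideal classes that kills the class of every prime containing `q` kills the class of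
every non-zero ideal containing `q`** (unique factorisation of ideals in the Dedekind domain `R`: such an
ideal is a product of primes each of which contains `q`). [folklore]
[cite: NeukirchANT1999, Ch. I §3 Thm. (3.3) (unique prime factorisation of ideals)] -/
private theorem map_mk0_eq_zero_of_mem {R : Type*} [CommRing R] [IsDedekindDomain R]
    {A : Type*} [AddCommGroup A] (f : Additive (ClassGroup R) →+ A) (q : R)
    (hq : ∀ (𝔓 : Ideal R) (h𝔓 : 𝔓 ≠ ⊥), 𝔓.IsPrime → q ∈ 𝔓 →
      f (Additive.ofMul (ClassGroup.mk0 ⟨𝔓, mem_nonZeroDivisors_of_ne_zero h𝔓⟩)) = 0)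
    (I : Ideal R) (hI : I ≠ ⊥) (hqI : q ∈ I) :
    f (Additive.ofMul (ClassGroup.mk0 ⟨I, mem_nonZeroDivisors_of_ne_zero hI⟩)) = 0 := by
  -- induction along the prime factorisation of `I`
  have key : ∀ J : Ideal R, ∀ (hJ : J ≠ ⊥), q ∈ J →
      f (Additive.ofMul (ClassGroup.mk0 ⟨J, mem_nonZeroDivisors_of_ne_zero hJ⟩)) = 0 := by
    intro J
    refine UniqueFactorizationMonoid.induction_on_prime J ?_ ?_ ?_
    · intro h0; exact absurd rfl h0
    · intro J hJu _ _
      have hJ1 : J = ⊤ := Ideal.isUnit_iff.mp hJu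
      have h1 : (⟨J, mem_nonZeroDivisors_of_ne_zero (by rw [hJ1]; exact top_ne_bot)⟩ : (Ideal R)⁰) = 1 :=
        Subtype.ext (by rw [OneMemClass.coe_one, Ideal.one_eq_top]; exact hJ1)
      have : ∀ h, f (Additive.ofMul (ClassGroup.mk0 ⟨J, h⟩)) = 0 := by
        intro h
        have hh : (⟨J, h⟩ : (Ideal R)⁰) = 1 := by rw [← h1]
        rw [hh, map_one, ofMul_one, map_zero]
      exact this _
    · intro J P hJ0 hP ih hJP hqJP
      have hP0 : P ≠ ⊥ := hP.ne_zero
      have hPprime : P.IsPrime := Ideal.isPrime_of_prime hP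
      have hJ : J ≠ ⊥ := hJ0
      have hqP : q ∈ P := Ideal.mul_le_right (hqJP)
      have hqJ : q ∈ J := Ideal.mul_le_left (hqJP)
      have hprod : (⟨P * J, mem_nonZeroDivisors_of_ne_zero hJP⟩ : (Ideal R)⁰) =
          ⟨P, mem_nonZeroDivisors_of_ne_zero hP0⟩ * ⟨J, mem_nonZeroDivisors_of_ne_zero hJ⟩ :=
        Subtype.ext rfl
      rw [hprod, map_mul, ofMul_mul, map_add, hq P hP0 hPprime hqP, ih hJ hqJ, add_zero]
  exact key I hI hqI

/-- The extension `𝔞𝓞_L` of a nonzero ideal `𝔞` of `𝓞 K` is nonzero. [folklore] -/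
private theorem extend_mem_nonZeroDivisors {K L : Type*} [Field K] [Field L] [Algebra K L]
    (I : (Ideal (𝓞 K))⁰) :
    (I : Ideal (𝓞 K)).map (algebraMap (𝓞 K) (𝓞 L)) ∈ (Ideal (𝓞 L))⁰ := by
  refine mem_nonZeroDivisors_of_ne_zero fun h => nonZeroDivisors.coe_ne_zero I ?_
  exact (Ideal.map_eq_bot_iff_of_injective (FaithfulSMul.algebraMap_injective (𝓞 K) (𝓞 L))).mp h

/-! ### The abstract statement -/

set_option maxHeartbeats 800000 in
/-- **Equivariant homomorphisms `Cl(𝓞_L) → V` killing the `S`-classes vanish when every `S`-split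
tautological eigenfunctional on `Cl(𝓞_K)` vanishes.**  Setting: `L/F` finite Galois inside `F̄` with
`p ∤ #Gal(L/F)`; `V` a `p`-torsion `Γ_F`-module trivialised by `Γ_L` whose only `Γ_F`-stable subgroups are
`⊥` and `⊤`; a subfield `K ⊆ L` whose absolute Galois group fixes a non-zero `P ∈ V`; `S` a set of natural
numbers (rational primes).  Hypothesis `hEig`: every additive `μ : Cl(𝓞_K) → ZMod p` such that
(i) `μ([σ̄ I]) = a • μ([I])` for all `τ ∈ Γ_F`, `σ̄ ∈ Aut(K/F)`, `a ∈ ℕ` with `τ|_K = σ̄` and `τ • P = a • P`,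
and (ii) `μ([𝔮]) = 0` for every prime `𝔮` of `K` containing some `q ∈ S`, is zero.  Conclusion: every
additive `f : Cl(𝓞_L) → V` that is `Γ_F`-equivariant (`f([τ I]) = τ • f([I])`, `τ I := (τ|_L)(I)` through
`AmbiguousClass.intAut`) and kills `[𝔓]` for every prime `𝔓` of `L` containing some `q ∈ S`, is zero.
Proof in the module docstring (character-weighted averaging over the stabiliser of the line `𝔽_p P`,
descent `μ̃ = μ ∘ i_{L/K}`, Neukirch III (1.6)(iv) on classes, irreducibility). [folklore]
[cite: NeukirchANT1999, Ch. III §1 Prop. (1.6) (iv)] [cite: DeoRaySujatha2023, §3 Thm. 3.8 (c2) and the definition of H′_L (arXiv:2202.09937 p. 9)] -/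
theorem equivariantHom_classGroup_eq_zero_of_eigenHom_subfield
    {F : Type} [Field F] (L : IntermediateField F (AlgebraicClosure F)) [FiniteDimensional F L]
    [IsGalois F L] [NumberField L] (p : ℕ) [Fact p.Prime]
    (hG : ¬ p ∣ Nat.card (L ≃ₐ[F] L))
    {V : Type*} [AddCommGroup V] [DistribMulAction (absoluteGaloisGroup F) V]
    (hV : ∀ τ : absoluteGaloisGroup F, absRestrictNormalHom L τ = 1 → ∀ v : V, τ • v = v)
    (hpV : ∀ v : V, p • v = 0)
    (hirr : ∀ U : AddSubgroup V,
      (∀ τ : absoluteGaloisGroup F, ∀ v ∈ U, τ • v ∈ U) → U = ⊥ ∨ U = ⊤)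
    (K : IntermediateField F L) [NumberField K]
    (P : V) (hP0 : P ≠ 0)
    (hPK : ∀ τ : absoluteGaloisGroup F, (∀ x : K, absRestrictNormalHom L τ (x : L) = x) → τ • P = P)
    (S : Set ℕ)
    (hEig : ∀ μ : Additive (ClassGroup (𝓞 K)) →+ ZMod p,
      (∀ (τ : absoluteGaloisGroup F) (σ : K ≃ₐ[F] K) (a : ℕ),
          (∀ x : K, absRestrictNormalHom L τ (x : L) = ((σ x : K) : L)) → τ • P = a • P →
          ∀ (I J : (Ideal (𝓞 K))⁰),
            (J : Ideal (𝓞 K)) = (I : Ideal (𝓞 K)).map (AmbiguousClass.intAut σ : 𝓞 K →+* 𝓞 K) →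
            μ (Additive.ofMul (ClassGroup.mk0 J)) = a • μ (Additive.ofMul (ClassGroup.mk0 I))) →
      (∀ (𝔮 : HeightOneSpectrum (𝓞 K)) (q : ℕ), q ∈ S → ((q : ℕ) : 𝓞 K) ∈ 𝔮.asIdeal →
          μ (Additive.ofMul (ClassGroup.mk0
            ⟨𝔮.asIdeal, mem_nonZeroDivisors_of_ne_zero 𝔮.ne_bot⟩)) = 0) →
      μ = 0)
    (f : Additive (ClassGroup (𝓞 L)) →+ V)
    (hf : ∀ (τ : absoluteGaloisGroup F) (I J : (Ideal (𝓞 L))⁰),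
      (J : Ideal (𝓞 L)) =
        (I : Ideal (𝓞 L)).map (AmbiguousClass.intAut (absRestrictNormalHom L τ) : 𝓞 L →+* 𝓞 L) →
      f (Additive.ofMul (ClassGroup.mk0 J)) = τ • f (Additive.ofMul (ClassGroup.mk0 I)))
    (hfS : ∀ (𝔓 : HeightOneSpectrum (𝓞 L)) (q : ℕ), q ∈ S → ((q : ℕ) : 𝓞 L) ∈ 𝔓.asIdeal →
      f (Additive.ofMul (ClassGroup.mk0
        ⟨𝔓.asIdeal, mem_nonZeroDivisors_of_ne_zero 𝔓.ne_bot⟩)) = 0) :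
    f = 0 := by
  have hp : p.Prime := Fact.out
  -- (S) elements of `Γ_F` with the same restriction to `L` act identically on `V`
  have hS : ∀ τ τ' : absoluteGaloisGroup F,
      absRestrictNormalHom L τ = absRestrictNormalHom L τ' → ∀ v : V, τ • v = τ' • v := by
    intro τ τ' h v
    have h1 : absRestrictNormalHom L (τ'⁻¹ * τ) = 1 := by
      rw [map_mul, map_inv, h, inv_mul_cancel]
    calc τ • v = (τ' * (τ'⁻¹ * τ)) • v := by rw [mul_inv_cancel_left]
      _ = τ' • v := by rw [mul_smul, hV _ h1 v]
  -- `τ • (n • v) = n • (τ • v)`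
  have hsm : ∀ (τ : absoluteGaloisGroup F) (n : ℕ) (v : V), τ • (n • v) = n • (τ • v) :=
    fun τ n v => map_nsmul (DistribSMul.toAddMonoidHom V τ) n v
  -- the `𝔽_p`-structure on `V`
  letI instM : Module (ZMod p) V := AddCommGroup.zmodModule hpV
  have hcast : ∀ (n : ℕ) (v : V), (n : ZMod p) • v = n • v := fun n v => Nat.cast_smul_eq_nsmul _ n v
  -- scalars along the line `𝔽_p P` are unique
  have huniq : ∀ a b : ZMod p, a • P = b • P → a = b := by
    intro a b hab
    by_contra hne
    have hsub : (a - b) • P = 0 := by rw [sub_smul, hab, sub_self]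
    have hab0 : a - b ≠ 0 := sub_ne_zero.mpr hne
    apply hP0
    calc P = (a - b)⁻¹ • ((a - b) • P) := by rw [smul_smul, inv_mul_cancel₀ hab0, one_smul]
      _ = 0 := by rw [hsub, smul_zero]
  -- lifts `Γ_F → Gal(L/F)`
  choose lift hlift using absRestrictNormalHom_surjective'' L
  -- the action of `G = Gal(L/F)` on `V` through lifts
  set act : (L ≃ₐ[F] L) → V → V := fun g v => lift g • v with hact
  have hact_res : ∀ (τ : absoluteGaloisGroup F) (v : V),
      act (absRestrictNormalHom L τ) v = τ • v := fun τ v => hS _ _ (hlift _) v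
  have hact_mul : ∀ (g h : L ≃ₐ[F] L) (v : V), act (g * h) v = act g (act h v) := by
    intro g h v
    change lift (g * h) • v = lift g • lift h • v
    rw [← mul_smul]
    exact hS _ _ (by rw [hlift, map_mul, hlift, hlift]) v
  have hact_one : ∀ v : V, act 1 v = v := fun v => hV _ (hlift 1) v
  have hact_nsmul : ∀ (g : L ≃ₐ[F] L) (n : ℕ) (v : V), act g (n • v) = n • act g v :=
    fun g n v => hsm _ n v
  have hact_zero : ∀ g : L ≃ₐ[F] L, act g 0 = 0 := fun g => smul_zero _
  -- the stabiliser `T` of the line through `P`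
  let T : Subgroup (L ≃ₐ[F] L) :=
    { carrier := {g | ∃ a b : ℕ, act g P = a • P ∧ act g⁻¹ P = b • P}
      one_mem' := ⟨1, 1, by rw [hact_one, one_smul], by rw [inv_one, hact_one, one_smul]⟩
      mul_mem' := by
        rintro g h ⟨a, b, hga, hgb⟩ ⟨c, d, hhc, hhd⟩
        refine ⟨c * a, b * d, ?_, ?_⟩
        · rw [hact_mul, hhc, hact_nsmul, hga, mul_smul]
        · rw [mul_inv_rev, hact_mul, hgb, hact_nsmul, hhd, mul_smul]
      inv_mem' := by
        rintro g ⟨a, b, hga, hgb⟩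
        exact ⟨b, a, hgb, by rw [inv_inv]; exact hga⟩ }
  have hmemT : ∀ g : L ≃ₐ[F] L, g ∈ T ↔ ∃ a b : ℕ, act g P = a • P ∧ act g⁻¹ P = b • P :=
    fun g => Iff.rfl
  -- `#T` is prime to `p` (Lagrange)
  have hTG : Nat.card T ∣ Nat.card (L ≃ₐ[F] L) := Subgroup.card_subgroup_dvd_card T
  have hTp : ¬ p ∣ Nat.card T := fun h => hG (h.trans hTG)
  have hTcast : (Nat.card T : ZMod p) ≠ 0 := by
    rw [Ne, ZMod.natCast_eq_zero_iff]
    exact hTp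
  -- the scalars `a_t` (`t ⋆ P = a_t • P`), as units of `𝔽_p`
  have hsc : ∀ t : T, ∃ a : ℕ, act (t : L ≃ₐ[F] L) P = a • P := fun t => by
    obtain ⟨a, b, ha, _⟩ := (hmemT t).mp t.2
    exact ⟨a, ha⟩
  choose sc hsc' using hsc
  have hsc0 : ∀ t : T, (sc t : ZMod p) ≠ 0 := by
    intro t h0
    obtain ⟨a, b, ha, hb⟩ := (hmemT t).mp t.2
    have h1 : act (t : L ≃ₐ[F] L) P = 0 := by rw [hsc' t, ← hcast, h0, zero_smul]
    apply hP0
    calc P = act ((t : L ≃ₐ[F] L)⁻¹ * t) P := by rw [inv_mul_cancel, hact_one]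
      _ = 0 := by rw [hact_mul, h1, hact_zero]
  -- multiplicativity of the scalars: `a_{u t} = a_u a_t` in `𝔽_p`
  have hsc_mul : ∀ u t : T, ((sc (u * t) : ℕ) : ZMod p) = (sc u : ZMod p) * (sc t : ZMod p) := by
    intro u t
    apply huniq
    rw [hcast, ← hsc', Subgroup.coe_mul, hact_mul, hsc' t, hact_nsmul, hsc' u, ← mul_smul, ← hcast,
      Nat.cast_mul, mul_comm]
  -- the character-weighted average `π`
  set π : V →+ V :=
    ∑ t : T, ((sc t : ZMod p)⁻¹) • DistribSMul.toAddMonoidHom V (lift (t : L ≃ₐ[F] L)) with hπdef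
  have hπ : ∀ v : V, π v = ∑ t : T, ((sc t : ZMod p)⁻¹) • act (t : L ≃ₐ[F] L) v := by
    intro v
    rw [hπdef, AddMonoidHom.finsetSum_apply]
    rfl
  -- `π(t₀ ⋆ v) = a_{t₀} • π(v)`
  have hπ_act : ∀ (t₀ : T) (v : V), π (act (t₀ : L ≃ₐ[F] L) v) = (sc t₀ : ZMod p) • π v := by
    intro t₀ v
    rw [hπ, hπ, Finset.smul_sum]
    rw [Fintype.sum_equiv (Equiv.mulRight t₀)
      (fun t : T => ((sc t : ZMod p)⁻¹) • act (t : L ≃ₐ[F] L) (act (t₀ : L ≃ₐ[F] L) v))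
      (fun u : T => ((sc (u * t₀⁻¹) : ZMod p)⁻¹) • act (u : L ≃ₐ[F] L) v) ?_]
    · refine Finset.sum_congr rfl fun u _ => ?_
      have h1 : ((sc (u * t₀⁻¹) : ℕ) : ZMod p) = (sc u : ZMod p) * ((sc t₀ : ZMod p))⁻¹ := by
        have h2 := hsc_mul (u * t₀⁻¹) t₀
        rw [inv_mul_cancel_right] at h2
        exact (eq_mul_inv_iff_mul_eq₀ (hsc0 t₀)).mpr h2.symm
      have hscu : (((sc (u * t₀⁻¹) : ℕ) : ZMod p))⁻¹ = (sc t₀ : ZMod p) * ((sc u : ZMod p))⁻¹ := by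
        rw [h1, mul_inv, inv_inv, mul_comm]
      rw [hscu, mul_smul]
    · intro t
      change ((sc t : ZMod p)⁻¹) • act (t : L ≃ₐ[F] L) (act (t₀ : L ≃ₐ[F] L) v) =
        ((sc (t * t₀ * t₀⁻¹) : ZMod p)⁻¹) • act ((t * t₀ : T) : L ≃ₐ[F] L) v
      rw [mul_inv_cancel_right, Subgroup.coe_mul, hact_mul]
  -- `π P = #T • P ≠ 0`
  have hπP : π P = (Nat.card T) • P := by
    rw [hπ]
    have key : ∀ t : T, ((sc t : ZMod p)⁻¹) • act (t : L ≃ₐ[F] L) P = P := by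
      intro t
      rw [hsc' t, ← hcast, smul_smul, inv_mul_cancel₀ (hsc0 t), one_smul]
    simp_rw [key]
    rw [Finset.sum_const, Finset.card_univ, Nat.card_eq_fintype_card]
  have hπP0 : π P ≠ 0 := by
    intro h0
    rw [hπP, ← hcast] at h0
    apply hP0
    calc P = ((Nat.card T : ZMod p))⁻¹ • ((Nat.card T : ZMod p) • P) := by
          rw [smul_smul, inv_mul_cancel₀ hTcast, one_smul]
      _ = 0 := by rw [h0, smul_zero]
  -- a separating `𝔽_p`-functional and the tautological eigenfunctional `ε = λ ∘ π`
  haveI instF : Module.Free (ZMod p) V := @Module.Free.of_divisionRing (ZMod p) V _ _ instM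
  haveI instP : Module.Projective (ZMod p) V :=
    @Module.Projective.of_free (ZMod p) _ V _ instM instF
  obtain ⟨lam, hlam⟩ := @Module.Projective.exists_dual_ne_zero V _ (ZMod p) _ instM instP _ hπP0
  set ε : V →+ ZMod p := lam.toAddMonoidHom.comp π with hεdef
  have hε : ∀ v, ε v = lam.toAddMonoidHom (π v) := fun v => rfl
  have hεP : ε P ≠ 0 := by rw [hε]; exact hlam
  -- the eigen-property of `ε`: `ε (τ • v) = a • ε v` whenever `τ • P = a • P`
  have hε_eig : ∀ (τ : absoluteGaloisGroup F) (a : ℕ), τ • P = a • P →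
      ∀ v : V, ε (τ • v) = a • ε v := by
    intro τ a hτ v
    have ha0 : (a : ZMod p) ≠ 0 := by
      intro h0
      have h1 : τ • P = 0 := by rw [hτ, ← hcast, h0, zero_smul]
      apply hP0
      calc P = τ⁻¹ • (τ • P) := by rw [smul_smul, inv_mul_cancel, one_smul]
        _ = 0 := by rw [h1, smul_zero]
    obtain ⟨b, hbcast⟩ : ∃ b : ℕ, (b : ZMod p) = ((a : ZMod p))⁻¹ :=
      ⟨((a : ZMod p)⁻¹).val, ZMod.natCast_zmod_val _⟩
    have hgT : absRestrictNormalHom L τ ∈ T := by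
      refine ⟨a, b, ?_, ?_⟩
      · rw [hact_res, hτ]
      · have h1 : act (absRestrictNormalHom L τ)⁻¹ (τ • P) = P := by
          rw [← hact_res τ P, ← hact_mul, inv_mul_cancel, hact_one]
        rw [hτ, hact_nsmul] at h1
        calc act (absRestrictNormalHom L τ)⁻¹ P
            = ((b : ZMod p) * (a : ZMod p)) • act (absRestrictNormalHom L τ)⁻¹ P := by
                rw [hbcast, inv_mul_cancel₀ ha0, one_smul]
          _ = b • (a • act (absRestrictNormalHom L τ)⁻¹ P) := by rw [mul_smul, hcast, hcast]
          _ = b • P := by rw [h1]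
    have key := hπ_act ⟨_, hgT⟩ v
    have hsca : ((sc ⟨_, hgT⟩ : ℕ) : ZMod p) = (a : ZMod p) := by
      apply huniq
      rw [hcast, hcast, ← hsc' ⟨_, hgT⟩]
      change act (absRestrictNormalHom L τ) P = a • P
      rw [hact_res, hτ]
    rw [hε, hε, ← hact_res τ v, key, hsca]
    simp only [LinearMap.toAddMonoidHom_coe]
    rw [LinearMap.map_smul, smul_eq_mul, nsmul_eq_mul]
  -- `μ = ε ∘ f` on `Cl_L` and its descent `μK = μ ∘ i_{L/K}` to `Cl_K`
  set μ : Additive (ClassGroup (𝓞 L)) →+ ZMod p := ε.comp f with hμdef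
  have hμ : ∀ c, μ c = ε (f c) := fun c => rfl
  set μK : Additive (ClassGroup (𝓞 K)) →+ ZMod p :=
    μ.comp (MonoidHom.toAdditive (classGroupExtend K L)) with hμKdef
  have hμK : ∀ d : ClassGroup (𝓞 K),
      μK (Additive.ofMul d) = μ (Additive.ofMul (classGroupExtend K L d)) := fun d => rfl
  -- (i) `μK` is a tautological eigenfunctional
  have hμK_eig : ∀ (τ : absoluteGaloisGroup F) (σ : K ≃ₐ[F] K) (a : ℕ),
      (∀ x : K, absRestrictNormalHom L τ (x : L) = ((σ x : K) : L)) → τ • P = a • P →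
      ∀ (I J : (Ideal (𝓞 K))⁰),
        (J : Ideal (𝓞 K)) = (I : Ideal (𝓞 K)).map (AmbiguousClass.intAut σ : 𝓞 K →+* 𝓞 K) →
        μK (Additive.ofMul (ClassGroup.mk0 J)) = a • μK (Additive.ofMul (ClassGroup.mk0 I)) := by
    intro τ σ a hτσ hτP I J hJ
    rw [hμK, hμK, classGroupExtend_mk0, classGroupExtend_mk0, hμ, hμ]
    -- `J 𝓞_L = (τ|_L)(I 𝓞_L)`
    have hJL : ((J : Ideal (𝓞 K)).map (algebraMap (𝓞 K) (𝓞 L))) =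
        ((I : Ideal (𝓞 K)).map (algebraMap (𝓞 K) (𝓞 L))).map
          (AmbiguousClass.intAut (absRestrictNormalHom L τ) : 𝓞 L →+* 𝓞 L) := by
      rw [hJ, Ideal.map_map, Ideal.map_map]
      congr 1
      refine RingHom.ext fun y => RingOfIntegers.ext ?_
      rw [RingHom.comp_apply, RingHom.comp_apply, RingHom.coe_coe, RingHom.coe_coe,
        RingOfIntegers.mapRingEquiv_apply]
      exact (hτσ (y : K)).symm
    rw [hf τ ⟨_, extend_mem_nonZeroDivisors (L := L) I⟩ ⟨_, extend_mem_nonZeroDivisors (L := L) J⟩ hJL]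
    exact hε_eig τ a hτP _
  -- (ii) `μK` kills the classes of the primes of `K` above `S`
  have hμK_S : ∀ (𝔮 : HeightOneSpectrum (𝓞 K)) (q : ℕ), q ∈ S → ((q : ℕ) : 𝓞 K) ∈ 𝔮.asIdeal →
      μK (Additive.ofMul (ClassGroup.mk0
        ⟨𝔮.asIdeal, mem_nonZeroDivisors_of_ne_zero 𝔮.ne_bot⟩)) = 0 := by
    intro 𝔮 q hq hq𝔮
    rw [hμK, classGroupExtend_mk0, hμ]
    have hne : (𝔮.asIdeal.map (algebraMap (𝓞 K) (𝓞 L))) ≠ ⊥ :=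
      nonZeroDivisors.coe_ne_zero
        (⟨_, extend_mem_nonZeroDivisors (L := L)
          ⟨𝔮.asIdeal, mem_nonZeroDivisors_of_ne_zero 𝔮.ne_bot⟩⟩ : (Ideal (𝓞 L))⁰)
    have hqL : ((q : ℕ) : 𝓞 L) ∈ 𝔮.asIdeal.map (algebraMap (𝓞 K) (𝓞 L)) := by
      have h1 := Ideal.mem_map_of_mem (algebraMap (𝓞 K) (𝓞 L)) hq𝔮
      rwa [map_natCast] at h1
    have key : f (Additive.ofMul (ClassGroup.mk0
        ⟨𝔮.asIdeal.map (algebraMap (𝓞 K) (𝓞 L)), mem_nonZeroDivisors_of_ne_zero hne⟩)) = 0 := by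
      refine map_mk0_eq_zero_of_mem f ((q : ℕ) : 𝓞 L) ?_ _ hne hqL
      intro 𝔓 h𝔓 hprime hq𝔓
      exact hfS ⟨𝔓, hprime, h𝔓⟩ q hq hq𝔓
    rw [key, map_zero]
  have hμK0 : μK = 0 := hEig μK hμK_eig hμK_S
  -- the subgroup `H = Gal(L/K)`, of order prime to `p`, fixes `P`: `μ` is `H`-invariant
  have hcardG : Nat.card (L ≃ₐ[F] L) = Module.finrank F L := IsGalois.card_aut_eq_finrank F L
  have hcardH : Fintype.card (L ≃ₐ[K] L) = Module.finrank K L := by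
    rw [← Nat.card_eq_fintype_card]; exact IsGalois.card_aut_eq_finrank K L
  have hH : ¬ p ∣ Fintype.card (L ≃ₐ[K] L) := by
    intro hdvd
    apply hG
    rw [hcardG, ← Module.finrank_mul_finrank F K L, ← hcardH]
    exact dvd_mul_of_dvd_right hdvd _
  have hHcop : (Fintype.card (L ≃ₐ[K] L)).Coprime p :=
    Nat.coprime_comm.mp ((Nat.Prime.coprime_iff_not_dvd hp).mpr hH)
  set tl : (L ≃ₐ[K] L) → absoluteGaloisGroup F := fun h => lift (h.restrictScalars F) with htl
  have htl_res : ∀ h : L ≃ₐ[K] L, absRestrictNormalHom L (tl h) = h.restrictScalars F :=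
    fun h => hlift _
  have htlP : ∀ h : L ≃ₐ[K] L, tl h • P = P := by
    intro h
    refine hPK _ fun x => ?_
    rw [htl_res]
    exact h.commutes x
  have hμ_gal : ∀ (h : L ≃ₐ[K] L) (c : ClassGroup (𝓞 L)),
      μ (Additive.ofMul (ClassGroup.mulEquiv (AmbiguousClass.intAut h) c)) = μ (Additive.ofMul c) := by
    intro h c
    obtain ⟨I, rfl⟩ := ClassGroup.mk0_surjective c
    rw [AmbiguousClass.mulEquiv_mk0]
    have hJ : (((⟨_, AmbiguousClass.map_mem_nonZeroDivisors h I⟩ : (Ideal (𝓞 L))⁰) : (Ideal (𝓞 L))⁰) :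
        Ideal (𝓞 L)) =
        (I : Ideal (𝓞 L)).map (AmbiguousClass.intAut (absRestrictNormalHom L (tl h)) : 𝓞 L →+* 𝓞 L) := by
      rw [htl_res]
      rfl
    rw [hμ, hμ, hf (tl h) I _ hJ, hε_eig (tl h) 1 (by rw [htlP, one_smul]), one_smul]
  -- `#H · μ(c) = μ(i(N c)) = μK(N c) = 0`: `μ = 0`
  have hμ_norm : ∀ c : ClassGroup (𝓞 L),
      Fintype.card (L ≃ₐ[K] L) • μ (Additive.ofMul c) =
        μ (Additive.ofMul (classGroupExtend K L (classGroupNorm K L c))) := by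
    intro c
    rw [classGroupExtend_classGroupNorm_eq_prod K L c, ofMul_prod, map_sum]
    simp_rw [hμ_gal]
    rw [Finset.sum_const, Finset.card_univ]
  have hpZ : ∀ m : ZMod p, p • m = 0 := fun m => by
    rw [nsmul_eq_mul, ZMod.natCast_self, zero_mul]
  have hμ0 : ∀ a, μ a = 0 := by
    intro a
    have hm : μ (Additive.ofMul (classGroupExtend K L (classGroupNorm K L (Additive.toMul a)))) = 0 := by
      rw [← hμK, hμK0, AddMonoidHom.zero_apply]
    refine eq_zero_of_nsmul_eq_zero_of_coprime' hHcop ?_ (hpZ _)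
    rw [← ofMul_toMul a, hμ_norm, hm]
  -- the `Γ_F`-stable subgroup `U = {v : ε(τ v) = 0 ∀ τ}` contains `f(Cl_L)` but not `P`
  set U : AddSubgroup V :=
    ⨅ τ : absoluteGaloisGroup F, (ε.comp (DistribSMul.toAddMonoidHom V τ)).ker with hUdef
  have hmemU : ∀ v : V, v ∈ U ↔ ∀ τ : absoluteGaloisGroup F, ε (τ • v) = 0 := by
    intro v
    rw [hUdef, AddSubgroup.mem_iInf]
    refine forall_congr' fun τ => ?_
    rw [AddMonoidHom.mem_ker]
    rfl
  have hUstab : ∀ τ : absoluteGaloisGroup F, ∀ v ∈ U, τ • v ∈ U := by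
    intro τ v hv
    rw [hmemU] at hv ⊢
    intro τ'
    rw [← mul_smul]
    exact hv _
  have hUP : P ∉ U := by
    intro hPU
    rw [hmemU] at hPU
    exact hεP (by simpa using hPU 1)
  have hUbot : U = ⊥ := by
    rcases hirr U hUstab with h | h
    · exact h
    · exact absurd (h ▸ AddSubgroup.mem_top P) hUP
  have hfU : ∀ a, f a ∈ U := by
    intro a
    obtain ⟨I, hI⟩ := ClassGroup.mk0_surjective (Additive.toMul a)
    have ha : a = Additive.ofMul (ClassGroup.mk0 I) := by rw [hI, ofMul_toMul]
    rw [hmemU, ha]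
    intro τ
    rw [← hf τ I ⟨_, AmbiguousClass.map_mem_nonZeroDivisors (absRestrictNormalHom L τ) I⟩ rfl, ← hμ]
    exact hμ0 _
  ext a
  have : f a ∈ (⊥ : AddSubgroup V) := hUbot ▸ hfU a
  rwa [AddSubgroup.mem_bot] at this

/-! ### The `p`-division field of an elliptic curve over `ℚ` -/

/-- **Hypothesis (c2) of `thm39_fineSelmerDual_moduleFinite_of_homTrivial_divisionField`, verbatim
(its `S`-split condition INCLUDED), from the tautological eigenspace of ONE torsion-point field.**  For
`W/ℚ` elliptic, `p` prime, `W[p]` irreducible, `p ∤ #Gal(ℚ(W[p])/ℚ)`, a subfield `K ⊆ ℚ(W[p])` whose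
absolute Galois group fixes a non-zero `P ∈ W[p]`, and such that every additive `μ : Cl(𝓞_K) → ZMod p`
which (i) satisfies `μ([σ̄ I]) = a • μ([I])` whenever `σ̄ ∈ Aut(K/ℚ)` is the restriction of a `τ ∈ Γ_ℚ`
with `τ • P = a • P`, and (ii) kills the class of every prime of `K` above `p` or above a prime of bad
reduction, vanishes: then every additive `f : Cl(𝓞_{ℚ(W[p])}) → W[p]` that is `Γ_ℚ`-equivariant in the
sense of the named fact and kills the classes of the primes of `ℚ(W[p])` above `p` and the bad primes is
zero.  Specialisation of `equivariantHom_classGroup_eq_zero_of_eigenHom_subfield` to `L = ℚ(W[p])`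
(`WeierstrassCurve.divisionField`), `V = W[p]` (`geomTorsion`),
`S = {q prime : q = p or W has bad reduction at q}`. [folklore]
[cite: DeoRaySujatha2023, §3 Thm. 3.8 (c2) and the definition of H′_L (arXiv:2202.09937 p. 9)]
[cite: NeukirchANT1999, Ch. III §1 Prop. (1.6) (iv)] -/
theorem homTrivial_divisionField_of_eigenHom_subfield
    (W : WeierstrassCurve ℚ) [W.IsElliptic] (p : ℕ) [Fact p.Prime] [NeZero p]
    [NumberField (W.divisionField p)]
    (hirr : W.HasIrreducibleModPGaloisRep p)
    (hG : ¬ p ∣ Nat.card ((W.divisionField p) ≃ₐ[ℚ] (W.divisionField p)))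
    (K : IntermediateField ℚ (W.divisionField p)) [NumberField K]
    (P : geomTorsion W (p : ℤ)) (hP0 : P ≠ 0)
    (hPK : ∀ τ : absoluteGaloisGroup ℚ,
      (∀ x : K, absRestrictNormalHom (W.divisionField p) τ (x : W.divisionField p) = x) → τ • P = P)
    (hEig : ∀ μ : Additive (ClassGroup (𝓞 K)) →+ ZMod p,
      (∀ (τ : absoluteGaloisGroup ℚ) (σ : K ≃ₐ[ℚ] K) (a : ℕ),
          (∀ x : K, absRestrictNormalHom (W.divisionField p) τ (x : W.divisionField p) =
            ((σ x : K) : W.divisionField p)) → τ • P = a • P →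
          ∀ (I J : (Ideal (𝓞 K))⁰),
            (J : Ideal (𝓞 K)) = (I : Ideal (𝓞 K)).map (AmbiguousClass.intAut σ : 𝓞 K →+* 𝓞 K) →
            μ (Additive.ofMul (ClassGroup.mk0 J)) = a • μ (Additive.ofMul (ClassGroup.mk0 I))) →
      (∀ (𝔮 : HeightOneSpectrum (𝓞 K)) (q : ℕ) (v : HeightOneSpectrum (𝓞 ℚ)), q.Prime →
          ((q : ℕ) : 𝓞 K) ∈ 𝔮.asIdeal → ((q : ℕ) : 𝓞 ℚ) ∈ v.asIdeal →
          (q = p ∨ ¬ W.HasGoodReductionAt v) →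
          μ (Additive.ofMul (ClassGroup.mk0
            ⟨𝔮.asIdeal, mem_nonZeroDivisors_of_ne_zero 𝔮.ne_bot⟩)) = 0) →
      μ = 0)
    (f : Additive (ClassGroup (𝓞 (W.divisionField p))) →+ geomTorsion W (p : ℤ))
    (hf : ∀ (τ : absoluteGaloisGroup ℚ) (I J : (Ideal (𝓞 (W.divisionField p)))⁰),
      (J : Ideal (𝓞 (W.divisionField p))) =
        (I : Ideal (𝓞 (W.divisionField p))).map
          (galRestrict ℤ ℚ (W.divisionField p) (𝓞 (W.divisionField p))
            (absRestrictNormalHom (W.divisionField p) τ)) →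
      f (Additive.ofMul (ClassGroup.mk0 J)) = τ • f (Additive.ofMul (ClassGroup.mk0 I)))
    (hfS : ∀ (𝔓 : HeightOneSpectrum (𝓞 (W.divisionField p))) (I : (Ideal (𝓞 (W.divisionField p)))⁰)
        (q : ℕ) (v : HeightOneSpectrum (𝓞 ℚ)), q.Prime →
        (I : Ideal (𝓞 (W.divisionField p))) = 𝔓.asIdeal →
        ((q : ℕ) : 𝓞 (W.divisionField p)) ∈ 𝔓.asIdeal → ((q : ℕ) : 𝓞 ℚ) ∈ v.asIdeal →
        (q = p ∨ ¬ W.HasGoodReductionAt v) →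
        f (Additive.ofMul (ClassGroup.mk0 I)) = 0) :
    f = 0 := by
  -- the set `S` of rational primes of the fact's (c2)/(c3): `p` and the bad primes
  let S : Set ℕ := {q | q.Prime ∧ ∃ v : HeightOneSpectrum (𝓞 ℚ),
    ((q : ℕ) : 𝓞 ℚ) ∈ v.asIdeal ∧ (q = p ∨ ¬ W.HasGoodReductionAt v)}
  refine equivariantHom_classGroup_eq_zero_of_eigenHom_subfield (W.divisionField p) p hG
    (fun τ hτ v => (W.absRestrictNormalHom_divisionField_eq_one_iff p τ).mp hτ v) ?_ hirr K P hP0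
    hPK S ?_ f ?_ ?_
  · -- `W[p]` is `p`-torsion
    intro v
    apply Subtype.ext
    have hv : ((v : geomTorsion W (p : ℤ)) : geomPoints W) ∈
        AddSubgroup.torsionBy (geomPoints W) (p : ℤ) := v.2
    rw [AddSubgroup.torsionBy, Submodule.mem_toAddSubgroup, Submodule.mem_torsionBy_iff] at hv
    rw [AddSubgroupClass.coe_nsmul, ZeroMemClass.coe_zero, ← natCast_zsmul]
    exact hv
  · -- the eigen-hypothesis, with `S` unfolded
    intro μ hμ1 hμ2
    refine hEig μ hμ1 ?_
    intro 𝔮 q v hqp hq𝔮 hqv hbad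
    exact hμ2 𝔮 q ⟨hqp, v, hqv, hbad⟩ hq𝔮
  · -- the fact's `galRestrict ℤ ℚ` phrasing of `τ·I` is the `intAut` phrasing (same underlying map)
    intro τ I J hJ
    refine hf τ I J ?_
    have key : ∀ x : 𝓞 (W.divisionField p),
        galRestrict ℤ ℚ (W.divisionField p) (𝓞 (W.divisionField p))
            (absRestrictNormalHom (W.divisionField p) τ) x =
          AmbiguousClass.intAut (absRestrictNormalHom (W.divisionField p) τ) x := by
      intro x
      refine RingOfIntegers.ext ?_
      exact algebraMap_galRestrict_apply ℤ _ x
    rw [hJ]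
    simp only [Ideal.map]
    congr 1
    ext y
    simp only [Set.mem_image, SetLike.mem_coe, RingHom.coe_coe, key]
  · -- the fact's `S`-condition gives `hfS`
    rintro 𝔓 q ⟨hqp, v, hqv, hbad⟩ hq𝔓
    exact hfS 𝔓 ⟨𝔓.asIdeal, mem_nonZeroDivisors_of_ne_zero 𝔓.ne_bot⟩ q v hqp rfl hq𝔓 hqv hbad

/-! ### Deo–Ray–Sujatha Thm. 3.9 (b) BY NAME, with (c2) from the tautological eigenspace of `Cl(ℚ(P))` -/

/-- **Deo–Ray–Sujatha 2023 Thm. 3.9 (b) (named fact `thm39_…_homTrivial_divisionField`, hypothesis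
`h`) with (c2) discharged by the `S`-split tautological-eigenspace condition on `K = ℚ(P)`** — `ℚ(P)`
being the fixed field, inside `ℚ(W[p])`, of (the image of) the stabiliser of a non-zero `p`-torsion
point `P` (`[ℚ(P):ℚ] = 8` on the `5Ns` rows, `24` on `5Nn/5S4`, where `Aut(ℚ(P)/ℚ) = ⟨σ₂ : P ↦ 2P⟩`).
Hypotheses: the named fact `h`; `p` odd; `W[p]` irreducible; (c1) `p ∤ #Gal(ℚ(W[p])/ℚ)`; `∃ P ≠ 0` such
that every additive `μ : Cl(𝓞_{ℚ(P)}) → ZMod p` with `μ ∘ σ̄ = a • μ` for the restrictions `σ̄` of the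
`τ ∈ Γ_ℚ` with `τ • P = a • P`, killing the classes of the primes of `ℚ(P)` above `p` and the bad
primes, vanishes (numerically: `a` is not an eigenvalue of `σ_a` on `(Cl(ℚ(P)) ⊗ 𝔽_p)/⟨[𝔮] : 𝔮 ∣ S⟩`);
(c3).  Conclusion: statement (A) for `W` at `p` (`∃ γ D` form).  Conditional only on `h`.  The
class-number form (`p ∤ h(ℚ(P))`, sibling file) is the case `Cl(ℚ(P)) ⊗ 𝔽_p = 0`.
[cite: DeoRaySujatha2023, §3 Thm. 3.8 (c2), Thm. 3.9 (b) (arXiv:2202.09937 pp. 9–10), §5 Lemma 5.1 (p. 17)]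
[cite: NeukirchANT1999, Ch. III §1 Prop. (1.6) (iv)] -/
theorem thm39_of_homTrivial_of_eigenHom_stabilizerField
    (h : thm39_fineSelmerDual_moduleFinite_of_homTrivial_divisionField)
    (W : WeierstrassCurve ℚ) [W.IsElliptic] (p : ℕ) [Fact p.Prime] (hp : p ≠ 2)
    (hirr : W.HasIrreducibleModPGaloisRep p)
    (hG : haveI : NeZero p := ⟨(Fact.out : p.Prime).ne_zero⟩
      ¬ p ∣ Nat.card ((W.divisionField p) ≃ₐ[ℚ] (W.divisionField p)))
    (hP : haveI : NeZero p := ⟨(Fact.out : p.Prime).ne_zero⟩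
      haveI : NumberField (W.divisionField p) := NumberField.mk
      ∃ P : geomTorsion W (p : ℤ), P ≠ 0 ∧
        ∀ K : IntermediateField ℚ (W.divisionField p),
          K = IntermediateField.fixedField
            ((MulAction.stabilizer (absoluteGaloisGroup ℚ) P).map
              (absRestrictNormalHom (W.divisionField p))) →
        ∀ μ : Additive (ClassGroup (𝓞 K)) →+ ZMod p,
        (∀ (τ : absoluteGaloisGroup ℚ) (σ : K ≃ₐ[ℚ] K) (a : ℕ),
          (∀ x : K, absRestrictNormalHom (W.divisionField p) τ (x : W.divisionField p) =
              ((σ x : K) : W.divisionField p)) →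
          τ • P = a • P →
          ∀ (I J : (Ideal (𝓞 K))⁰),
            (J : Ideal (𝓞 K)) = (I : Ideal (𝓞 K)).map (AmbiguousClass.intAut σ : 𝓞 K →+* 𝓞 K) →
            μ (Additive.ofMul (ClassGroup.mk0 J)) = a • μ (Additive.ofMul (ClassGroup.mk0 I))) →
        (∀ (𝔮 : HeightOneSpectrum (𝓞 K)) (q : ℕ) (v : HeightOneSpectrum (𝓞 ℚ)), q.Prime →
            ((q : ℕ) : 𝓞 K) ∈ 𝔮.asIdeal → ((q : ℕ) : 𝓞 ℚ) ∈ v.asIdeal →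
            (q = p ∨ ¬ W.HasGoodReductionAt v) →
            μ (Additive.ofMul (ClassGroup.mk0
              ⟨𝔮.asIdeal, mem_nonZeroDivisors_of_ne_zero 𝔮.ne_bot⟩)) = 0) →
        μ = 0)
    (hloc : ∀ v : HeightOneSpectrum (𝓞 ℚ), (((p : ℕ) : 𝓞 ℚ) ∈ v.asIdeal ∨ ¬ W.HasGoodReductionAt v) →
      ∀ x : W.geomPrimaryTorsion p, p • x = 0 →
        (∀ d ∈ Literature.NumberTheory.EllipticCurves.GreenbergSelmer.decomp v, d • x = x) → x = 0)
    (κ : ZpExtension ℚ p) (hκ : κ.IsCyclotomic) :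
    ∃ (γ : absoluteGaloisGroup ℚ) (D : W.FineSelmerDualData κ γ),
      Module.Finite ℤ_[p] (RestrictScalars ℤ_[p] (IwasawaAlgebra p) D.X) := by
  haveI : NeZero p := ⟨(Fact.out : p.Prime).ne_zero⟩
  haveI : NumberField (W.divisionField p) := NumberField.mk
  obtain ⟨P, hP0, hEig⟩ := hP
  refine h W p hp hirr hG ?_ hloc κ hκ
  intro f hf hfS
  refine homTrivial_divisionField_of_eigenHom_subfield W p hirr hG _ P hP0 ?_ (hEig _ rfl) f hf hfS
  -- `τ|_L` fixes the fixed field of `Stab(P)|_L`, so `τ|_L = τ₀|_L` with `τ₀ P = P`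
  intro τ hτ
  have hmem : absRestrictNormalHom (W.divisionField p) τ ∈
      (MulAction.stabilizer (absoluteGaloisGroup ℚ) P).map (absRestrictNormalHom (W.divisionField p)) := by
    rw [← IntermediateField.fixingSubgroup_fixedField
      ((MulAction.stabilizer (absoluteGaloisGroup ℚ) P).map (absRestrictNormalHom (W.divisionField p))),
      IntermediateField.mem_fixingSubgroup_iff]
    intro x hx
    exact hτ ⟨x, hx⟩
  obtain ⟨τ₀, hτ₀, hres⟩ := Subgroup.mem_map.mp hmem
  have h1 : absRestrictNormalHom (W.divisionField p) (τ₀⁻¹ * τ) = 1 := by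
    rw [map_mul, map_inv, hres, inv_mul_cancel]
  have h2 := (W.absRestrictNormalHom_divisionField_eq_one_iff p (τ₀⁻¹ * τ)).mp h1 P
  rw [mul_smul, inv_smul_eq_iff] at h2
  rw [h2]
  exact hτ₀

/-! ## APPEND (same seat, 2026-08-28): the Hecke refinement (Lemma⁗)

WHY.  On the cell's 11 ♭ rows left undecided by the `S`-split eigenvalue test (kit j309542: the `5`-part of
`Cl(ℚ(P))` IS a tautological eigenline and the `S`-classes are `5`-trivial) the question is whether that line is the
`E[5]`-isotypic part of `Cl(ℚ(E[5]))/5` or one of its two companions with the same central character; the Hecke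
operator `[𝔞] ↦ [N_{L/K}((τ|_L)(𝔞𝓞_L))]` (computable in the relative quadratic extension `L/K`, no class group of `L`)
separates them, and the descended functional of the proof satisfies the corresponding relation (iii) below.

PROOF OF (iii) (formalised in `equivariantHom_classGroup_eq_zero_of_heckeEigenHom_subfield`, hypothesis `hμK_hecke`).
With `ε`, `μ = ε ∘ f`, `μ̃ = μ ∘ i_{L/K}` as in the module docstring: for an ideal `I` of `𝓞_K` the class `i[I]` is fixed
by every `τ ∈ Γ_F` restricting to the identity of `K` (the extended ideal is), so by equivariance `f(i[I]) ∈ V^{Γ_K}`,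
i.e. `f(i[I]) = c • P` (`hVH`).  If `τ • P = a • P + Q`, `τ₁ • P = a₁ • P`, `τ₁ • Q = b • Q` with `a₁ ≠ b (mod p)`, then
`ε(Q) = 0` (`a₁ ε(Q) = ε(τ₁ Q) = b ε(Q)`), so `μ((τ|_L) · i[I]) = ε(τ (c • P)) = c a ε(P) = a • μ̃([I])`; and for every
class `c′` of `L`, `μ̃(N c′) = μ(i N c′) = Σ_{h ∈ Gal(L/K)} μ(h c′) = #Gal(L/K) • μ(c′)` (Neukirch III (1.6)(iv) on
classes = the tree's `classGroupExtend_classGroupNorm_eq_prod`, and the `Gal(L/K)`-invariance of `μ`).  Hence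
`μ̃(N((τ|_L) · i[I])) = (#Gal(L/K) · a) • μ̃([I])`.  The two specialisations are those of the first part of the file
(`L = ℚ(W[p])`, `V = W[p]`, `S = {p} ∪ {bad primes}`; `K = ℚ(P)` the fixed field of the stabiliser of `P`, where
`hVH` becomes `W[p]^{Stab P} = ℕ P`). -/

set_option maxHeartbeats 1200000 in
/-- **Hecke refinement (Lemma⁗): equivariant homomorphisms `Cl(𝓞_L) → V` killing the `S`-classes vanish when
every `S`-split tautological eigenfunctional on `Cl(𝓞_K)` SATISFYING THE HECKE RELATIONS vanishes.**  Same setting as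
`equivariantHom_classGroup_eq_zero_of_eigenHom_subfield`, plus `hVH`: the vectors of `V` fixed by `Γ_K` are the multiples
of `P`.  The descended functional `μ̃ = ε ∘ f ∘ i_{L/K}` then ALSO satisfies, for every `τ ∈ Γ_F` with
`τ • P = a • P + Q` where `Q` lies in another eigenline of some `τ₁` scaling `P` (`τ₁ • P = a₁ • P`, `τ₁ • Q = b • Q`,
`a₁ ≠ b mod p`): `μ̃(N_{L/K}((τ|_L) · i_{L/K}[I])) = (#Gal(L/K) · a) • μ̃([I])` — the HECKE RELATION (iii) (`T_τ = Σ_{h} h τ` on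
`Cl_L^{Gal(L/K)} = i(Cl_K)` acts on the descended functional by the `P`-coordinate `a` of `τ P`; for `V = E[5]` with
non-split Cartan normaliser image and `τ` of order `24` this eigenvalue is the trace `Tr ρ̄(τ)`, while the companions
`ρ̄ ⊗ ε′`, `V₉` of `ρ̄` in the tautological eigenspace have eigenvalues `−Tr ρ̄(τ)`, `0`).  So hypothesis `hEig` may assume
(i), (ii) AND (iii) before concluding `μ = 0`: **if every `S`-split tautological eigenfunctional satisfying the Hecke
relations vanishes, then (c2) holds.**  Setting: `L/F` finite Galois inside `F̄` with
`p ∤ #Gal(L/F)`; `V` a `p`-torsion `Γ_F`-module trivialised by `Γ_L` whose only `Γ_F`-stable subgroups are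
`⊥` and `⊤`; a subfield `K ⊆ L` whose absolute Galois group fixes a non-zero `P ∈ V`; `S` a set of natural
numbers (rational primes).  Hypothesis `hEig`: every additive `μ : Cl(𝓞_K) → ZMod p` such that
(i) `μ([σ̄ I]) = a • μ([I])` for all `τ ∈ Γ_F`, `σ̄ ∈ Aut(K/F)`, `a ∈ ℕ` with `τ|_K = σ̄` and `τ • P = a • P`,
and (ii) `μ([𝔮]) = 0` for every prime `𝔮` of `K` containing some `q ∈ S`, is zero.  Conclusion: every
additive `f : Cl(𝓞_L) → V` that is `Γ_F`-equivariant (`f([τ I]) = τ • f([I])`, `τ I := (τ|_L)(I)` through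
`AmbiguousClass.intAut`) and kills `[𝔓]` for every prime `𝔓` of `L` containing some `q ∈ S`, is zero.
Proof in the module docstring (character-weighted averaging over the stabiliser of the line `𝔽_p P`,
descent `μ̃ = μ ∘ i_{L/K}`, Neukirch III (1.6)(iv) on classes, irreducibility). [folklore]
[cite: NeukirchANT1999, Ch. III §1 Prop. (1.6) (iv)] [cite: DeoRaySujatha2023, §3 Thm. 3.8 (c2) and the definition of H′_L (arXiv:2202.09937 p. 9)] -/
theorem equivariantHom_classGroup_eq_zero_of_heckeEigenHom_subfield
    {F : Type} [Field F] (L : IntermediateField F (AlgebraicClosure F)) [FiniteDimensional F L]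
    [IsGalois F L] [NumberField L] (p : ℕ) [Fact p.Prime]
    (hG : ¬ p ∣ Nat.card (L ≃ₐ[F] L))
    {V : Type*} [AddCommGroup V] [DistribMulAction (absoluteGaloisGroup F) V]
    (hV : ∀ τ : absoluteGaloisGroup F, absRestrictNormalHom L τ = 1 → ∀ v : V, τ • v = v)
    (hpV : ∀ v : V, p • v = 0)
    (hirr : ∀ U : AddSubgroup V,
      (∀ τ : absoluteGaloisGroup F, ∀ v ∈ U, τ • v ∈ U) → U = ⊥ ∨ U = ⊤)
    (K : IntermediateField F L) [NumberField K]
    (P : V) (hP0 : P ≠ 0)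
    (hPK : ∀ τ : absoluteGaloisGroup F, (∀ x : K, absRestrictNormalHom L τ (x : L) = x) → τ • P = P)
    (hVH : ∀ v : V, (∀ τ : absoluteGaloisGroup F, (∀ x : K, absRestrictNormalHom L τ (x : L) = x) → τ • v = v) →
      ∃ c : ℕ, v = c • P)
    (S : Set ℕ)
    (hEig : ∀ μ : Additive (ClassGroup (𝓞 K)) →+ ZMod p,
      (∀ (τ : absoluteGaloisGroup F) (σ : K ≃ₐ[F] K) (a : ℕ),
          (∀ x : K, absRestrictNormalHom L τ (x : L) = ((σ x : K) : L)) → τ • P = a • P →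
          ∀ (I J : (Ideal (𝓞 K))⁰),
            (J : Ideal (𝓞 K)) = (I : Ideal (𝓞 K)).map (AmbiguousClass.intAut σ : 𝓞 K →+* 𝓞 K) →
            μ (Additive.ofMul (ClassGroup.mk0 J)) = a • μ (Additive.ofMul (ClassGroup.mk0 I))) →
      (∀ (𝔮 : HeightOneSpectrum (𝓞 K)) (q : ℕ), q ∈ S → ((q : ℕ) : 𝓞 K) ∈ 𝔮.asIdeal →
          μ (Additive.ofMul (ClassGroup.mk0
            ⟨𝔮.asIdeal, mem_nonZeroDivisors_of_ne_zero 𝔮.ne_bot⟩)) = 0) →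
      (∀ (τ τ₁ : absoluteGaloisGroup F) (a a₁ b : ℕ) (Q : V),
          τ • P = a • P + Q → τ₁ • P = a₁ • P → τ₁ • Q = b • Q → (a₁ : ZMod p) ≠ (b : ZMod p) →
          ∀ I : (Ideal (𝓞 K))⁰,
            μ (Additive.ofMul (classGroupNorm K L (ClassGroup.mulEquiv
              (AmbiguousClass.intAut (absRestrictNormalHom L τ)) (classGroupExtend K L (ClassGroup.mk0 I))))) =
              (Nat.card (L ≃ₐ[K] L) * a) • μ (Additive.ofMul (ClassGroup.mk0 I))) →
      μ = 0)
    (f : Additive (ClassGroup (𝓞 L)) →+ V)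
    (hf : ∀ (τ : absoluteGaloisGroup F) (I J : (Ideal (𝓞 L))⁰),
      (J : Ideal (𝓞 L)) =
        (I : Ideal (𝓞 L)).map (AmbiguousClass.intAut (absRestrictNormalHom L τ) : 𝓞 L →+* 𝓞 L) →
      f (Additive.ofMul (ClassGroup.mk0 J)) = τ • f (Additive.ofMul (ClassGroup.mk0 I)))
    (hfS : ∀ (𝔓 : HeightOneSpectrum (𝓞 L)) (q : ℕ), q ∈ S → ((q : ℕ) : 𝓞 L) ∈ 𝔓.asIdeal →
      f (Additive.ofMul (ClassGroup.mk0
        ⟨𝔓.asIdeal, mem_nonZeroDivisors_of_ne_zero 𝔓.ne_bot⟩)) = 0) :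
    f = 0 := by
  have hp : p.Prime := Fact.out
  -- (S) elements of `Γ_F` with the same restriction to `L` act identically on `V`
  have hS : ∀ τ τ' : absoluteGaloisGroup F,
      absRestrictNormalHom L τ = absRestrictNormalHom L τ' → ∀ v : V, τ • v = τ' • v := by
    intro τ τ' h v
    have h1 : absRestrictNormalHom L (τ'⁻¹ * τ) = 1 := by
      rw [map_mul, map_inv, h, inv_mul_cancel]
    calc τ • v = (τ' * (τ'⁻¹ * τ)) • v := by rw [mul_inv_cancel_left]
      _ = τ' • v := by rw [mul_smul, hV _ h1 v]
  -- `τ • (n • v) = n • (τ • v)`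
  have hsm : ∀ (τ : absoluteGaloisGroup F) (n : ℕ) (v : V), τ • (n • v) = n • (τ • v) :=
    fun τ n v => map_nsmul (DistribSMul.toAddMonoidHom V τ) n v
  -- the `𝔽_p`-structure on `V`
  letI instM : Module (ZMod p) V := AddCommGroup.zmodModule hpV
  have hcast : ∀ (n : ℕ) (v : V), (n : ZMod p) • v = n • v := fun n v => Nat.cast_smul_eq_nsmul _ n v
  -- scalars along the line `𝔽_p P` are unique
  have huniq : ∀ a b : ZMod p, a • P = b • P → a = b := by
    intro a b hab
    by_contra hne
    have hsub : (a - b) • P = 0 := by rw [sub_smul, hab, sub_self]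
    have hab0 : a - b ≠ 0 := sub_ne_zero.mpr hne
    apply hP0
    calc P = (a - b)⁻¹ • ((a - b) • P) := by rw [smul_smul, inv_mul_cancel₀ hab0, one_smul]
      _ = 0 := by rw [hsub, smul_zero]
  -- lifts `Γ_F → Gal(L/F)`
  choose lift hlift using absRestrictNormalHom_surjective'' L
  -- the action of `G = Gal(L/F)` on `V` through lifts
  set act : (L ≃ₐ[F] L) → V → V := fun g v => lift g • v with hact
  have hact_res : ∀ (τ : absoluteGaloisGroup F) (v : V),
      act (absRestrictNormalHom L τ) v = τ • v := fun τ v => hS _ _ (hlift _) v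
  have hact_mul : ∀ (g h : L ≃ₐ[F] L) (v : V), act (g * h) v = act g (act h v) := by
    intro g h v
    change lift (g * h) • v = lift g • lift h • v
    rw [← mul_smul]
    exact hS _ _ (by rw [hlift, map_mul, hlift, hlift]) v
  have hact_one : ∀ v : V, act 1 v = v := fun v => hV _ (hlift 1) v
  have hact_nsmul : ∀ (g : L ≃ₐ[F] L) (n : ℕ) (v : V), act g (n • v) = n • act g v :=
    fun g n v => hsm _ n v
  have hact_zero : ∀ g : L ≃ₐ[F] L, act g 0 = 0 := fun g => smul_zero _
  -- the stabiliser `T` of the line through `P`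
  let T : Subgroup (L ≃ₐ[F] L) :=
    { carrier := {g | ∃ a b : ℕ, act g P = a • P ∧ act g⁻¹ P = b • P}
      one_mem' := ⟨1, 1, by rw [hact_one, one_smul], by rw [inv_one, hact_one, one_smul]⟩
      mul_mem' := by
        rintro g h ⟨a, b, hga, hgb⟩ ⟨c, d, hhc, hhd⟩
        refine ⟨c * a, b * d, ?_, ?_⟩
        · rw [hact_mul, hhc, hact_nsmul, hga, mul_smul]
        · rw [mul_inv_rev, hact_mul, hgb, hact_nsmul, hhd, mul_smul]
      inv_mem' := by
        rintro g ⟨a, b, hga, hgb⟩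
        exact ⟨b, a, hgb, by rw [inv_inv]; exact hga⟩ }
  have hmemT : ∀ g : L ≃ₐ[F] L, g ∈ T ↔ ∃ a b : ℕ, act g P = a • P ∧ act g⁻¹ P = b • P :=
    fun g => Iff.rfl
  -- `#T` is prime to `p` (Lagrange)
  have hTG : Nat.card T ∣ Nat.card (L ≃ₐ[F] L) := Subgroup.card_subgroup_dvd_card T
  have hTp : ¬ p ∣ Nat.card T := fun h => hG (h.trans hTG)
  have hTcast : (Nat.card T : ZMod p) ≠ 0 := by
    rw [Ne, ZMod.natCast_eq_zero_iff]
    exact hTp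
  -- the scalars `a_t` (`t ⋆ P = a_t • P`), as units of `𝔽_p`
  have hsc : ∀ t : T, ∃ a : ℕ, act (t : L ≃ₐ[F] L) P = a • P := fun t => by
    obtain ⟨a, b, ha, _⟩ := (hmemT t).mp t.2
    exact ⟨a, ha⟩
  choose sc hsc' using hsc
  have hsc0 : ∀ t : T, (sc t : ZMod p) ≠ 0 := by
    intro t h0
    obtain ⟨a, b, ha, hb⟩ := (hmemT t).mp t.2
    have h1 : act (t : L ≃ₐ[F] L) P = 0 := by rw [hsc' t, ← hcast, h0, zero_smul]
    apply hP0
    calc P = act ((t : L ≃ₐ[F] L)⁻¹ * t) P := by rw [inv_mul_cancel, hact_one]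
      _ = 0 := by rw [hact_mul, h1, hact_zero]
  -- multiplicativity of the scalars: `a_{u t} = a_u a_t` in `𝔽_p`
  have hsc_mul : ∀ u t : T, ((sc (u * t) : ℕ) : ZMod p) = (sc u : ZMod p) * (sc t : ZMod p) := by
    intro u t
    apply huniq
    rw [hcast, ← hsc', Subgroup.coe_mul, hact_mul, hsc' t, hact_nsmul, hsc' u, ← mul_smul, ← hcast,
      Nat.cast_mul, mul_comm]
  -- the character-weighted average `π`
  set π : V →+ V :=
    ∑ t : T, ((sc t : ZMod p)⁻¹) • DistribSMul.toAddMonoidHom V (lift (t : L ≃ₐ[F] L)) with hπdef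
  have hπ : ∀ v : V, π v = ∑ t : T, ((sc t : ZMod p)⁻¹) • act (t : L ≃ₐ[F] L) v := by
    intro v
    rw [hπdef, AddMonoidHom.finsetSum_apply]
    rfl
  -- `π(t₀ ⋆ v) = a_{t₀} • π(v)`
  have hπ_act : ∀ (t₀ : T) (v : V), π (act (t₀ : L ≃ₐ[F] L) v) = (sc t₀ : ZMod p) • π v := by
    intro t₀ v
    rw [hπ, hπ, Finset.smul_sum]
    rw [Fintype.sum_equiv (Equiv.mulRight t₀)
      (fun t : T => ((sc t : ZMod p)⁻¹) • act (t : L ≃ₐ[F] L) (act (t₀ : L ≃ₐ[F] L) v))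
      (fun u : T => ((sc (u * t₀⁻¹) : ZMod p)⁻¹) • act (u : L ≃ₐ[F] L) v) ?_]
    · refine Finset.sum_congr rfl fun u _ => ?_
      have h1 : ((sc (u * t₀⁻¹) : ℕ) : ZMod p) = (sc u : ZMod p) * ((sc t₀ : ZMod p))⁻¹ := by
        have h2 := hsc_mul (u * t₀⁻¹) t₀
        rw [inv_mul_cancel_right] at h2
        exact (eq_mul_inv_iff_mul_eq₀ (hsc0 t₀)).mpr h2.symm
      have hscu : (((sc (u * t₀⁻¹) : ℕ) : ZMod p))⁻¹ = (sc t₀ : ZMod p) * ((sc u : ZMod p))⁻¹ := by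
        rw [h1, mul_inv, inv_inv, mul_comm]
      rw [hscu, mul_smul]
    · intro t
      change ((sc t : ZMod p)⁻¹) • act (t : L ≃ₐ[F] L) (act (t₀ : L ≃ₐ[F] L) v) =
        ((sc (t * t₀ * t₀⁻¹) : ZMod p)⁻¹) • act ((t * t₀ : T) : L ≃ₐ[F] L) v
      rw [mul_inv_cancel_right, Subgroup.coe_mul, hact_mul]
  -- `π P = #T • P ≠ 0`
  have hπP : π P = (Nat.card T) • P := by
    rw [hπ]
    have key : ∀ t : T, ((sc t : ZMod p)⁻¹) • act (t : L ≃ₐ[F] L) P = P := by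
      intro t
      rw [hsc' t, ← hcast, smul_smul, inv_mul_cancel₀ (hsc0 t), one_smul]
    simp_rw [key]
    rw [Finset.sum_const, Finset.card_univ, Nat.card_eq_fintype_card]
  have hπP0 : π P ≠ 0 := by
    intro h0
    rw [hπP, ← hcast] at h0
    apply hP0
    calc P = ((Nat.card T : ZMod p))⁻¹ • ((Nat.card T : ZMod p) • P) := by
          rw [smul_smul, inv_mul_cancel₀ hTcast, one_smul]
      _ = 0 := by rw [h0, smul_zero]
  -- a separating `𝔽_p`-functional and the tautological eigenfunctional `ε = λ ∘ π`
  haveI instF : Module.Free (ZMod p) V := @Module.Free.of_divisionRing (ZMod p) V _ _ instM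
  haveI instP : Module.Projective (ZMod p) V :=
    @Module.Projective.of_free (ZMod p) _ V _ instM instF
  obtain ⟨lam, hlam⟩ := @Module.Projective.exists_dual_ne_zero V _ (ZMod p) _ instM instP _ hπP0
  set ε : V →+ ZMod p := lam.toAddMonoidHom.comp π with hεdef
  have hε : ∀ v, ε v = lam.toAddMonoidHom (π v) := fun v => rfl
  have hεP : ε P ≠ 0 := by rw [hε]; exact hlam
  -- the eigen-property of `ε`: `ε (τ • v) = a • ε v` whenever `τ • P = a • P`
  have hε_eig : ∀ (τ : absoluteGaloisGroup F) (a : ℕ), τ • P = a • P →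
      ∀ v : V, ε (τ • v) = a • ε v := by
    intro τ a hτ v
    have ha0 : (a : ZMod p) ≠ 0 := by
      intro h0
      have h1 : τ • P = 0 := by rw [hτ, ← hcast, h0, zero_smul]
      apply hP0
      calc P = τ⁻¹ • (τ • P) := by rw [smul_smul, inv_mul_cancel, one_smul]
        _ = 0 := by rw [h1, smul_zero]
    obtain ⟨b, hbcast⟩ : ∃ b : ℕ, (b : ZMod p) = ((a : ZMod p))⁻¹ :=
      ⟨((a : ZMod p)⁻¹).val, ZMod.natCast_zmod_val _⟩
    have hgT : absRestrictNormalHom L τ ∈ T := by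
      refine ⟨a, b, ?_, ?_⟩
      · rw [hact_res, hτ]
      · have h1 : act (absRestrictNormalHom L τ)⁻¹ (τ • P) = P := by
          rw [← hact_res τ P, ← hact_mul, inv_mul_cancel, hact_one]
        rw [hτ, hact_nsmul] at h1
        calc act (absRestrictNormalHom L τ)⁻¹ P
            = ((b : ZMod p) * (a : ZMod p)) • act (absRestrictNormalHom L τ)⁻¹ P := by
                rw [hbcast, inv_mul_cancel₀ ha0, one_smul]
          _ = b • (a • act (absRestrictNormalHom L τ)⁻¹ P) := by rw [mul_smul, hcast, hcast]
          _ = b • P := by rw [h1]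
    have key := hπ_act ⟨_, hgT⟩ v
    have hsca : ((sc ⟨_, hgT⟩ : ℕ) : ZMod p) = (a : ZMod p) := by
      apply huniq
      rw [hcast, hcast, ← hsc' ⟨_, hgT⟩]
      change act (absRestrictNormalHom L τ) P = a • P
      rw [hact_res, hτ]
    rw [hε, hε, ← hact_res τ v, key, hsca]
    simp only [LinearMap.toAddMonoidHom_coe]
    rw [LinearMap.map_smul, smul_eq_mul, nsmul_eq_mul]
  -- `μ = ε ∘ f` on `Cl_L` and its descent `μK = μ ∘ i_{L/K}` to `Cl_K`
  set μ : Additive (ClassGroup (𝓞 L)) →+ ZMod p := ε.comp f with hμdef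
  have hμ : ∀ c, μ c = ε (f c) := fun c => rfl
  set μK : Additive (ClassGroup (𝓞 K)) →+ ZMod p :=
    μ.comp (MonoidHom.toAdditive (classGroupExtend K L)) with hμKdef
  have hμK : ∀ d : ClassGroup (𝓞 K),
      μK (Additive.ofMul d) = μ (Additive.ofMul (classGroupExtend K L d)) := fun d => rfl
  -- (i) `μK` is a tautological eigenfunctional
  have hμK_eig : ∀ (τ : absoluteGaloisGroup F) (σ : K ≃ₐ[F] K) (a : ℕ),
      (∀ x : K, absRestrictNormalHom L τ (x : L) = ((σ x : K) : L)) → τ • P = a • P →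
      ∀ (I J : (Ideal (𝓞 K))⁰),
        (J : Ideal (𝓞 K)) = (I : Ideal (𝓞 K)).map (AmbiguousClass.intAut σ : 𝓞 K →+* 𝓞 K) →
        μK (Additive.ofMul (ClassGroup.mk0 J)) = a • μK (Additive.ofMul (ClassGroup.mk0 I)) := by
    intro τ σ a hτσ hτP I J hJ
    rw [hμK, hμK, classGroupExtend_mk0, classGroupExtend_mk0, hμ, hμ]
    -- `J 𝓞_L = (τ|_L)(I 𝓞_L)`
    have hJL : ((J : Ideal (𝓞 K)).map (algebraMap (𝓞 K) (𝓞 L))) =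
        ((I : Ideal (𝓞 K)).map (algebraMap (𝓞 K) (𝓞 L))).map
          (AmbiguousClass.intAut (absRestrictNormalHom L τ) : 𝓞 L →+* 𝓞 L) := by
      rw [hJ, Ideal.map_map, Ideal.map_map]
      congr 1
      refine RingHom.ext fun y => RingOfIntegers.ext ?_
      rw [RingHom.comp_apply, RingHom.comp_apply, RingHom.coe_coe, RingHom.coe_coe,
        RingOfIntegers.mapRingEquiv_apply]
      exact (hτσ (y : K)).symm
    rw [hf τ ⟨_, extend_mem_nonZeroDivisors (L := L) I⟩ ⟨_, extend_mem_nonZeroDivisors (L := L) J⟩ hJL]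
    exact hε_eig τ a hτP _
  -- (ii) `μK` kills the classes of the primes of `K` above `S`
  have hμK_S : ∀ (𝔮 : HeightOneSpectrum (𝓞 K)) (q : ℕ), q ∈ S → ((q : ℕ) : 𝓞 K) ∈ 𝔮.asIdeal →
      μK (Additive.ofMul (ClassGroup.mk0
        ⟨𝔮.asIdeal, mem_nonZeroDivisors_of_ne_zero 𝔮.ne_bot⟩)) = 0 := by
    intro 𝔮 q hq hq𝔮
    rw [hμK, classGroupExtend_mk0, hμ]
    have hne : (𝔮.asIdeal.map (algebraMap (𝓞 K) (𝓞 L))) ≠ ⊥ :=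
      nonZeroDivisors.coe_ne_zero
        (⟨_, extend_mem_nonZeroDivisors (L := L)
          ⟨𝔮.asIdeal, mem_nonZeroDivisors_of_ne_zero 𝔮.ne_bot⟩⟩ : (Ideal (𝓞 L))⁰)
    have hqL : ((q : ℕ) : 𝓞 L) ∈ 𝔮.asIdeal.map (algebraMap (𝓞 K) (𝓞 L)) := by
      have h1 := Ideal.mem_map_of_mem (algebraMap (𝓞 K) (𝓞 L)) hq𝔮
      rwa [map_natCast] at h1
    have key : f (Additive.ofMul (ClassGroup.mk0
        ⟨𝔮.asIdeal.map (algebraMap (𝓞 K) (𝓞 L)), mem_nonZeroDivisors_of_ne_zero hne⟩)) = 0 := by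
      refine map_mk0_eq_zero_of_mem f ((q : ℕ) : 𝓞 L) ?_ _ hne hqL
      intro 𝔓 h𝔓 hprime hq𝔓
      exact hfS ⟨𝔓, hprime, h𝔓⟩ q hq hq𝔓
    rw [key, map_zero]
  -- the subgroup `H = Gal(L/K)`, of order prime to `p`, fixes `P`: `μ` is `H`-invariant
  have hcardG : Nat.card (L ≃ₐ[F] L) = Module.finrank F L := IsGalois.card_aut_eq_finrank F L
  have hcardH : Fintype.card (L ≃ₐ[K] L) = Module.finrank K L := by
    rw [← Nat.card_eq_fintype_card]; exact IsGalois.card_aut_eq_finrank K L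
  have hH : ¬ p ∣ Fintype.card (L ≃ₐ[K] L) := by
    intro hdvd
    apply hG
    rw [hcardG, ← Module.finrank_mul_finrank F K L, ← hcardH]
    exact dvd_mul_of_dvd_right hdvd _
  have hHcop : (Fintype.card (L ≃ₐ[K] L)).Coprime p :=
    Nat.coprime_comm.mp ((Nat.Prime.coprime_iff_not_dvd hp).mpr hH)
  set tl : (L ≃ₐ[K] L) → absoluteGaloisGroup F := fun h => lift (h.restrictScalars F) with htl
  have htl_res : ∀ h : L ≃ₐ[K] L, absRestrictNormalHom L (tl h) = h.restrictScalars F :=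
    fun h => hlift _
  have htlP : ∀ h : L ≃ₐ[K] L, tl h • P = P := by
    intro h
    refine hPK _ fun x => ?_
    rw [htl_res]
    exact h.commutes x
  have hμ_gal : ∀ (h : L ≃ₐ[K] L) (c : ClassGroup (𝓞 L)),
      μ (Additive.ofMul (ClassGroup.mulEquiv (AmbiguousClass.intAut h) c)) = μ (Additive.ofMul c) := by
    intro h c
    obtain ⟨I, rfl⟩ := ClassGroup.mk0_surjective c
    rw [AmbiguousClass.mulEquiv_mk0]
    have hJ : (((⟨_, AmbiguousClass.map_mem_nonZeroDivisors h I⟩ : (Ideal (𝓞 L))⁰) : (Ideal (𝓞 L))⁰) :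
        Ideal (𝓞 L)) =
        (I : Ideal (𝓞 L)).map (AmbiguousClass.intAut (absRestrictNormalHom L (tl h)) : 𝓞 L →+* 𝓞 L) := by
      rw [htl_res]
      rfl
    rw [hμ, hμ, hf (tl h) I _ hJ, hε_eig (tl h) 1 (by rw [htlP, one_smul]), one_smul]
  -- `#H · μ(c) = Σ_h μ(h c) = μ(i(N c))`
  have hμ_norm : ∀ c : ClassGroup (𝓞 L),
      Fintype.card (L ≃ₐ[K] L) • μ (Additive.ofMul c) =
        μ (Additive.ofMul (classGroupExtend K L (classGroupNorm K L c))) := by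
    intro c
    rw [classGroupExtend_classGroupNorm_eq_prod K L c, ofMul_prod, map_sum]
    simp_rw [hμ_gal]
    rw [Finset.sum_const, Finset.card_univ]
  -- (iii) the Hecke relations for `μK`
  have hext_fix : ∀ (τ : absoluteGaloisGroup F), (∀ x : K, absRestrictNormalHom L τ (x : L) = x) →
      ∀ I : (Ideal (𝓞 K))⁰,
        ((I : Ideal (𝓞 K)).map (algebraMap (𝓞 K) (𝓞 L))).map
            (AmbiguousClass.intAut (absRestrictNormalHom L τ) : 𝓞 L →+* 𝓞 L) =
          (I : Ideal (𝓞 K)).map (algebraMap (𝓞 K) (𝓞 L)) := by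
    intro τ hτ I
    rw [Ideal.map_map]
    congr 1
    refine RingHom.ext fun y => RingOfIntegers.ext ?_
    rw [RingHom.comp_apply, RingHom.coe_coe, RingOfIntegers.mapRingEquiv_apply]
    exact hτ (y : K)
  have hfix_ext : ∀ I : (Ideal (𝓞 K))⁰, ∃ c : ℕ,
      f (Additive.ofMul (classGroupExtend K L (ClassGroup.mk0 I))) = c • P := by
    intro I
    refine hVH _ fun τ hτ => ?_
    rw [classGroupExtend_mk0]
    exact (hf τ ⟨_, extend_mem_nonZeroDivisors (L := L) I⟩ ⟨_, extend_mem_nonZeroDivisors (L := L) I⟩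
      (hext_fix τ hτ I).symm).symm
  have hμK_hecke : ∀ (τ τ₁ : absoluteGaloisGroup F) (a a₁ b : ℕ) (Q : V),
      τ • P = a • P + Q → τ₁ • P = a₁ • P → τ₁ • Q = b • Q → (a₁ : ZMod p) ≠ (b : ZMod p) →
      ∀ I : (Ideal (𝓞 K))⁰,
        μK (Additive.ofMul (classGroupNorm K L (ClassGroup.mulEquiv
          (AmbiguousClass.intAut (absRestrictNormalHom L τ)) (classGroupExtend K L (ClassGroup.mk0 I))))) =
          (Nat.card (L ≃ₐ[K] L) * a) • μK (Additive.ofMul (ClassGroup.mk0 I)) := by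
    intro τ τ₁ a a₁ b Q hτP hτ₁P hτ₁Q hab I
    -- `ε(Q) = 0`: `ε(τ₁ Q) = a₁ ε(Q) = b ε(Q)`
    have hεQ : ε Q = 0 := by
      have h1 : ε (τ₁ • Q) = a₁ • ε Q := hε_eig τ₁ a₁ hτ₁P Q
      rw [hτ₁Q, map_nsmul] at h1
      rw [nsmul_eq_mul, nsmul_eq_mul] at h1
      have h2 : ((a₁ : ZMod p) - (b : ZMod p)) * ε Q = 0 := by rw [sub_mul, ← h1, sub_self]
      rcases mul_eq_zero.mp h2 with h3 | h3
      · exact absurd (sub_eq_zero.mp h3) hab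
      · exact h3
    -- the class `c′ = (τ|_L) · i[I]` and `μ(c′) = a • μK[I]`
    obtain ⟨c, hc⟩ := hfix_ext I
    have e1 : f (Additive.ofMul (ClassGroup.mulEquiv (AmbiguousClass.intAut (absRestrictNormalHom L τ))
        (classGroupExtend K L (ClassGroup.mk0 I)))) = τ • (c • P) := by
      rw [← hc, classGroupExtend_mk0, AmbiguousClass.mulEquiv_mk0]
      exact hf τ ⟨_, extend_mem_nonZeroDivisors (L := L) I⟩
        ⟨_, AmbiguousClass.map_mem_nonZeroDivisors (absRestrictNormalHom L τ)
          ⟨_, extend_mem_nonZeroDivisors (L := L) I⟩⟩ rfl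
    -- `μK(N c′) = μ(i N c′) = #H • μ(c′)` (by `hμ_norm`) and `μ(c′) = ε(τ (c • P)) = (c a) ε(P) = a • μK[I]`
    have hμc' : μ (Additive.ofMul (ClassGroup.mulEquiv (AmbiguousClass.intAut (absRestrictNormalHom L τ))
        (classGroupExtend K L (ClassGroup.mk0 I)))) = a • μK (Additive.ofMul (ClassGroup.mk0 I)) := by
      rw [hμ, e1, hμK, hμ, hc, hsm, map_nsmul, hτP, map_add, hεQ, add_zero, map_nsmul, map_nsmul, smul_comm]
    rw [hμK, ← hμ_norm, hμc', ← Nat.card_eq_fintype_card]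
    exact (mul_nsmul' _ _ _).symm
  have hμK0 : μK = 0 := hEig μK hμK_eig hμK_S hμK_hecke
  -- `#H · μ(c) = μ(i(N c)) = μK(N c) = 0`: `μ = 0`
  have hpZ : ∀ m : ZMod p, p • m = 0 := fun m => by
    rw [nsmul_eq_mul, ZMod.natCast_self, zero_mul]
  have hμ0 : ∀ a, μ a = 0 := by
    intro a
    have hm : μ (Additive.ofMul (classGroupExtend K L (classGroupNorm K L (Additive.toMul a)))) = 0 := by
      rw [← hμK, hμK0, AddMonoidHom.zero_apply]
    refine eq_zero_of_nsmul_eq_zero_of_coprime' hHcop ?_ (hpZ _)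
    rw [← ofMul_toMul a, hμ_norm, hm]
  -- the `Γ_F`-stable subgroup `U = {v : ε(τ v) = 0 ∀ τ}` contains `f(Cl_L)` but not `P`
  set U : AddSubgroup V :=
    ⨅ τ : absoluteGaloisGroup F, (ε.comp (DistribSMul.toAddMonoidHom V τ)).ker with hUdef
  have hmemU : ∀ v : V, v ∈ U ↔ ∀ τ : absoluteGaloisGroup F, ε (τ • v) = 0 := by
    intro v
    rw [hUdef, AddSubgroup.mem_iInf]
    refine forall_congr' fun τ => ?_
    rw [AddMonoidHom.mem_ker]
    rfl
  have hUstab : ∀ τ : absoluteGaloisGroup F, ∀ v ∈ U, τ • v ∈ U := by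
    intro τ v hv
    rw [hmemU] at hv ⊢
    intro τ'
    rw [← mul_smul]
    exact hv _
  have hUP : P ∉ U := by
    intro hPU
    rw [hmemU] at hPU
    exact hεP (by simpa using hPU 1)
  have hUbot : U = ⊥ := by
    rcases hirr U hUstab with h | h
    · exact h
    · exact absurd (h ▸ AddSubgroup.mem_top P) hUP
  have hfU : ∀ a, f a ∈ U := by
    intro a
    obtain ⟨I, hI⟩ := ClassGroup.mk0_surjective (Additive.toMul a)
    have ha : a = Additive.ofMul (ClassGroup.mk0 I) := by rw [hI, ofMul_toMul]
    rw [hmemU, ha]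
    intro τ
    rw [← hf τ I ⟨_, AmbiguousClass.map_mem_nonZeroDivisors (absRestrictNormalHom L τ) I⟩ rfl, ← hμ]
    exact hμ0 _
  ext a
  have : f a ∈ (⊥ : AddSubgroup V) := hUbot ▸ hfU a
  rwa [AddSubgroup.mem_bot] at this


/-! ### The Hecke refinement for the `p`-division field of an elliptic curve over `ℚ` -/

/-- **Hypothesis (c2) of `thm39_fineSelmerDual_moduleFinite_of_homTrivial_divisionField`, verbatim (its
`S`-split condition INCLUDED), from the tautological eigenspace of ONE torsion-point field, HECKE-REFINED.**  As
`homTrivial_divisionField_of_eigenHom_subfield`, with the extra hypothesis `hVH` (the vectors of `W[p]` fixed by every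
`τ ∈ Γ_ℚ` acting trivially on `K` are the multiples of `P`) and with `hEig` weakened: the additive
`μ : Cl(𝓞_K) → ZMod p` may be assumed to satisfy (i), (ii) AND the Hecke relations (iii)
`μ(N_{ℚ(W[p])/K}((τ|_{ℚ(W[p])}) · i[I])) = (#Gal(ℚ(W[p])/K) · a) • μ([I])` for every `τ` with `τ • P = a • P + Q`,
`Q` in an eigenline of some `τ₁` with `τ₁ • P = a₁ • P`, `τ₁ • Q = b • Q`, `a₁ ≠ b (mod p)`, before concluding
`μ = 0`.  Specialisation of `equivariantHom_classGroup_eq_zero_of_heckeEigenHom_subfield` to `L = ℚ(W[p])`,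
`V = W[p]`, `S = {q prime : q = p or W has bad reduction at q}`. [folklore]
[cite: DeoRaySujatha2023, §3 Thm. 3.8 (c2) and the definition of H′_L (arXiv:2202.09937 p. 9)]
[cite: NeukirchANT1999, Ch. III §1 Prop. (1.6) (iv)] -/
theorem homTrivial_divisionField_of_heckeEigenHom_subfield
    (W : WeierstrassCurve ℚ) [W.IsElliptic] (p : ℕ) [Fact p.Prime] [NeZero p]
    [NumberField (W.divisionField p)]
    (hirr : W.HasIrreducibleModPGaloisRep p)
    (hG : ¬ p ∣ Nat.card ((W.divisionField p) ≃ₐ[ℚ] (W.divisionField p)))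
    (K : IntermediateField ℚ (W.divisionField p)) [NumberField K]
    (P : geomTorsion W (p : ℤ)) (hP0 : P ≠ 0)
    (hPK : ∀ τ : absoluteGaloisGroup ℚ,
      (∀ x : K, absRestrictNormalHom (W.divisionField p) τ (x : W.divisionField p) = x) → τ • P = P)
    (hVH : ∀ v : geomTorsion W (p : ℤ), (∀ τ : absoluteGaloisGroup ℚ,
      (∀ x : K, absRestrictNormalHom (W.divisionField p) τ (x : W.divisionField p) = x) → τ • v = v) →
      ∃ c : ℕ, v = c • P)
    (hEig : ∀ μ : Additive (ClassGroup (𝓞 K)) →+ ZMod p,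
      (∀ (τ : absoluteGaloisGroup ℚ) (σ : K ≃ₐ[ℚ] K) (a : ℕ),
          (∀ x : K, absRestrictNormalHom (W.divisionField p) τ (x : W.divisionField p) =
            ((σ x : K) : W.divisionField p)) → τ • P = a • P →
          ∀ (I J : (Ideal (𝓞 K))⁰),
            (J : Ideal (𝓞 K)) = (I : Ideal (𝓞 K)).map (AmbiguousClass.intAut σ : 𝓞 K →+* 𝓞 K) →
            μ (Additive.ofMul (ClassGroup.mk0 J)) = a • μ (Additive.ofMul (ClassGroup.mk0 I))) →
      (∀ (𝔮 : HeightOneSpectrum (𝓞 K)) (q : ℕ) (v : HeightOneSpectrum (𝓞 ℚ)), q.Prime →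
          ((q : ℕ) : 𝓞 K) ∈ 𝔮.asIdeal → ((q : ℕ) : 𝓞 ℚ) ∈ v.asIdeal →
          (q = p ∨ ¬ W.HasGoodReductionAt v) →
          μ (Additive.ofMul (ClassGroup.mk0
            ⟨𝔮.asIdeal, mem_nonZeroDivisors_of_ne_zero 𝔮.ne_bot⟩)) = 0) →
      (∀ (τ τ₁ : absoluteGaloisGroup ℚ) (a a₁ b : ℕ) (Q : geomTorsion W (p : ℤ)),
          τ • P = a • P + Q → τ₁ • P = a₁ • P → τ₁ • Q = b • Q → (a₁ : ZMod p) ≠ (b : ZMod p) →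
          ∀ I : (Ideal (𝓞 K))⁰,
            μ (Additive.ofMul (classGroupNorm K (W.divisionField p) (ClassGroup.mulEquiv
              (AmbiguousClass.intAut (absRestrictNormalHom (W.divisionField p) τ))
              (classGroupExtend K (W.divisionField p) (ClassGroup.mk0 I))))) =
              (Nat.card ((W.divisionField p) ≃ₐ[K] (W.divisionField p)) * a) •
                μ (Additive.ofMul (ClassGroup.mk0 I))) →
      μ = 0)
    (f : Additive (ClassGroup (𝓞 (W.divisionField p))) →+ geomTorsion W (p : ℤ))
    (hf : ∀ (τ : absoluteGaloisGroup ℚ) (I J : (Ideal (𝓞 (W.divisionField p)))⁰),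
      (J : Ideal (𝓞 (W.divisionField p))) =
        (I : Ideal (𝓞 (W.divisionField p))).map
          (galRestrict ℤ ℚ (W.divisionField p) (𝓞 (W.divisionField p))
            (absRestrictNormalHom (W.divisionField p) τ)) →
      f (Additive.ofMul (ClassGroup.mk0 J)) = τ • f (Additive.ofMul (ClassGroup.mk0 I)))
    (hfS : ∀ (𝔓 : HeightOneSpectrum (𝓞 (W.divisionField p))) (I : (Ideal (𝓞 (W.divisionField p)))⁰)
        (q : ℕ) (v : HeightOneSpectrum (𝓞 ℚ)), q.Prime →
        (I : Ideal (𝓞 (W.divisionField p))) = 𝔓.asIdeal →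
        ((q : ℕ) : 𝓞 (W.divisionField p)) ∈ 𝔓.asIdeal → ((q : ℕ) : 𝓞 ℚ) ∈ v.asIdeal →
        (q = p ∨ ¬ W.HasGoodReductionAt v) →
        f (Additive.ofMul (ClassGroup.mk0 I)) = 0) :
    f = 0 := by
  -- the set `S` of rational primes of the fact's (c2)/(c3): `p` and the bad primes
  let S : Set ℕ := {q | q.Prime ∧ ∃ v : HeightOneSpectrum (𝓞 ℚ),
    ((q : ℕ) : 𝓞 ℚ) ∈ v.asIdeal ∧ (q = p ∨ ¬ W.HasGoodReductionAt v)}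
  refine equivariantHom_classGroup_eq_zero_of_heckeEigenHom_subfield (W.divisionField p) p hG
    (fun τ hτ v => (W.absRestrictNormalHom_divisionField_eq_one_iff p τ).mp hτ v) ?_ hirr K P hP0
    hPK hVH S ?_ f ?_ ?_
  · -- `W[p]` is `p`-torsion
    intro v
    apply Subtype.ext
    have hv : ((v : geomTorsion W (p : ℤ)) : geomPoints W) ∈
        AddSubgroup.torsionBy (geomPoints W) (p : ℤ) := v.2
    rw [AddSubgroup.torsionBy, Submodule.mem_toAddSubgroup, Submodule.mem_torsionBy_iff] at hv
    rw [AddSubgroupClass.coe_nsmul, ZeroMemClass.coe_zero, ← natCast_zsmul]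
    exact hv
  · -- the eigen-hypothesis, with `S` unfolded
    intro μ hμ1 hμ2 hμ3
    refine hEig μ hμ1 ?_ hμ3
    intro 𝔮 q v hqp hq𝔮 hqv hbad
    exact hμ2 𝔮 q ⟨hqp, v, hqv, hbad⟩ hq𝔮
  · -- the fact's `galRestrict ℤ ℚ` phrasing of `τ·I` is the `intAut` phrasing (same underlying map)
    intro τ I J hJ
    refine hf τ I J ?_
    have key : ∀ x : 𝓞 (W.divisionField p),
        galRestrict ℤ ℚ (W.divisionField p) (𝓞 (W.divisionField p))
            (absRestrictNormalHom (W.divisionField p) τ) x =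
          AmbiguousClass.intAut (absRestrictNormalHom (W.divisionField p) τ) x := by
      intro x
      refine RingOfIntegers.ext ?_
      exact algebraMap_galRestrict_apply ℤ _ x
    rw [hJ]
    simp only [Ideal.map]
    congr 1
    ext y
    simp only [Set.mem_image, SetLike.mem_coe, RingHom.coe_coe, key]
  · -- the fact's `S`-condition gives `hfS`
    rintro 𝔓 q ⟨hqp, v, hqv, hbad⟩ hq𝔓
    exact hfS 𝔓 ⟨𝔓.asIdeal, mem_nonZeroDivisors_of_ne_zero 𝔓.ne_bot⟩ q v hqp rfl hq𝔓 hqv hbad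

/-! ### Deo–Ray–Sujatha Thm. 3.9 (b) BY NAME, with (c2) from the Hecke-refined eigenspace condition on `Cl(ℚ(P))` -/

/-- **Deo–Ray–Sujatha 2023 Thm. 3.9 (b) (named fact `thm39_…_homTrivial_divisionField`, hypothesis `h`) with
(c2) discharged by the HECKE-REFINED `S`-split tautological-eigenspace condition on `K = ℚ(P)`** (the fixed
field, inside `ℚ(W[p])`, of the image of the stabiliser of a non-zero `p`-torsion point `P`).  Hypotheses: the
named fact `h`; `p` odd; `W[p]` irreducible; (c1) `p ∤ #Gal(ℚ(W[p])/ℚ)`; `∃ P ≠ 0` such that (α) the points of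
`W[p]` fixed by the stabiliser of `P` in `Γ_ℚ` are the multiples of `P` (`W[p]^{Stab P} = 𝔽_p P`), and (β) every
additive `μ : Cl(𝓞_{ℚ(P)}) → ZMod p` satisfying (i) `μ ∘ σ̄ = a • μ` for the restrictions `σ̄` of the `τ ∈ Γ_ℚ`
with `τ • P = a • P`, (ii) `μ` kills the classes of the primes of `ℚ(P)` above `p` and the bad primes, and
(iii) the Hecke relations `μ(N((τ|_{ℚ(W[p])}) · i[I])) = (#Gal(ℚ(W[p])/ℚ(P)) · a) • μ([I])` (`τ • P = a • P + Q`
as in `equivariantHom_classGroup_eq_zero_of_heckeEigenHom_subfield`), vanishes — numerically: the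
tautological `5`-eigenline of `Cl(ℚ(P))` is NOT of `ρ̄`-type under the Hecke operator of an element of order
`24`; (c3).  Conclusion: statement (A) for `W` at `p` (`∃ γ D` form).  Conditional only on `h`.
[cite: DeoRaySujatha2023, §3 Thm. 3.8 (c2), Thm. 3.9 (b) (arXiv:2202.09937 pp. 9–10), §5 Lemma 5.1 (p. 17)]
[cite: NeukirchANT1999, Ch. III §1 Prop. (1.6) (iv)] -/
theorem thm39_of_homTrivial_of_heckeEigenHom_stabilizerField
    (h : thm39_fineSelmerDual_moduleFinite_of_homTrivial_divisionField)
    (W : WeierstrassCurve ℚ) [W.IsElliptic] (p : ℕ) [Fact p.Prime] (hp : p ≠ 2)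
    (hirr : W.HasIrreducibleModPGaloisRep p)
    (hG : haveI : NeZero p := ⟨(Fact.out : p.Prime).ne_zero⟩
      ¬ p ∣ Nat.card ((W.divisionField p) ≃ₐ[ℚ] (W.divisionField p)))
    (hP : haveI : NeZero p := ⟨(Fact.out : p.Prime).ne_zero⟩
      haveI : NumberField (W.divisionField p) := NumberField.mk
      ∃ P : geomTorsion W (p : ℤ), P ≠ 0 ∧
        (∀ v : geomTorsion W (p : ℤ),
          (∀ τ ∈ MulAction.stabilizer (absoluteGaloisGroup ℚ) P, τ • v = v) → ∃ c : ℕ, v = c • P) ∧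
        ∀ K : IntermediateField ℚ (W.divisionField p),
          K = IntermediateField.fixedField
            ((MulAction.stabilizer (absoluteGaloisGroup ℚ) P).map
              (absRestrictNormalHom (W.divisionField p))) →
        ∀ μ : Additive (ClassGroup (𝓞 K)) →+ ZMod p,
        (∀ (τ : absoluteGaloisGroup ℚ) (σ : K ≃ₐ[ℚ] K) (a : ℕ),
          (∀ x : K, absRestrictNormalHom (W.divisionField p) τ (x : W.divisionField p) =
              ((σ x : K) : W.divisionField p)) →
          τ • P = a • P →
          ∀ (I J : (Ideal (𝓞 K))⁰),
            (J : Ideal (𝓞 K)) = (I : Ideal (𝓞 K)).map (AmbiguousClass.intAut σ : 𝓞 K →+* 𝓞 K) →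
            μ (Additive.ofMul (ClassGroup.mk0 J)) = a • μ (Additive.ofMul (ClassGroup.mk0 I))) →
        (∀ (𝔮 : HeightOneSpectrum (𝓞 K)) (q : ℕ) (v : HeightOneSpectrum (𝓞 ℚ)), q.Prime →
            ((q : ℕ) : 𝓞 K) ∈ 𝔮.asIdeal → ((q : ℕ) : 𝓞 ℚ) ∈ v.asIdeal →
            (q = p ∨ ¬ W.HasGoodReductionAt v) →
            μ (Additive.ofMul (ClassGroup.mk0
              ⟨𝔮.asIdeal, mem_nonZeroDivisors_of_ne_zero 𝔮.ne_bot⟩)) = 0) →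
        (∀ (τ τ₁ : absoluteGaloisGroup ℚ) (a a₁ b : ℕ) (Q : geomTorsion W (p : ℤ)),
            τ • P = a • P + Q → τ₁ • P = a₁ • P → τ₁ • Q = b • Q → (a₁ : ZMod p) ≠ (b : ZMod p) →
            ∀ I : (Ideal (𝓞 K))⁰,
              μ (Additive.ofMul (classGroupNorm K (W.divisionField p) (ClassGroup.mulEquiv
                (AmbiguousClass.intAut (absRestrictNormalHom (W.divisionField p) τ))
                (classGroupExtend K (W.divisionField p) (ClassGroup.mk0 I))))) =
                (Nat.card ((W.divisionField p) ≃ₐ[K] (W.divisionField p)) * a) •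
                  μ (Additive.ofMul (ClassGroup.mk0 I))) →
        μ = 0)
    (hloc : ∀ v : HeightOneSpectrum (𝓞 ℚ), (((p : ℕ) : 𝓞 ℚ) ∈ v.asIdeal ∨ ¬ W.HasGoodReductionAt v) →
      ∀ x : W.geomPrimaryTorsion p, p • x = 0 →
        (∀ d ∈ Literature.NumberTheory.EllipticCurves.GreenbergSelmer.decomp v, d • x = x) → x = 0)
    (κ : ZpExtension ℚ p) (hκ : κ.IsCyclotomic) :
    ∃ (γ : absoluteGaloisGroup ℚ) (D : W.FineSelmerDualData κ γ),
      Module.Finite ℤ_[p] (RestrictScalars ℤ_[p] (IwasawaAlgebra p) D.X) := by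
  haveI : NeZero p := ⟨(Fact.out : p.Prime).ne_zero⟩
  haveI : NumberField (W.divisionField p) := NumberField.mk
  obtain ⟨P, hP0, hVH, hEig⟩ := hP
  refine h W p hp hirr hG ?_ hloc κ hκ
  intro f hf hfS
  refine homTrivial_divisionField_of_heckeEigenHom_subfield W p hirr hG _ P hP0 ?_ ?_ (hEig _ rfl)
    f hf hfS
  swap
  · -- a vector fixed by every `τ` with `τ|_L` trivial on the fixed field of `Stab(P)|_L` is `Stab(P)`-fixed
    intro v hv
    refine hVH v fun τ hτ => hv τ fun x => ?_
    exact (IntermediateField.mem_fixedField_iff _ _).mp x.2 _ (Subgroup.mem_map_of_mem _ hτ)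
  -- `τ|_L` fixes the fixed field of `Stab(P)|_L`, so `τ|_L = τ₀|_L` with `τ₀ P = P`
  intro τ hτ
  have hmem : absRestrictNormalHom (W.divisionField p) τ ∈
      (MulAction.stabilizer (absoluteGaloisGroup ℚ) P).map (absRestrictNormalHom (W.divisionField p)) := by
    rw [← IntermediateField.fixingSubgroup_fixedField
      ((MulAction.stabilizer (absoluteGaloisGroup ℚ) P).map (absRestrictNormalHom (W.divisionField p))),
      IntermediateField.mem_fixingSubgroup_iff]
    intro x hx
    exact hτ ⟨x, hx⟩
  obtain ⟨τ₀, hτ₀, hres⟩ := Subgroup.mem_map.mp hmem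
  have h1 : absRestrictNormalHom (W.divisionField p) (τ₀⁻¹ * τ) = 1 := by
    rw [map_mul, map_inv, hres, inv_mul_cancel]
  have h2 := (W.absRestrictNormalHom_divisionField_eq_one_iff p (τ₀⁻¹ * τ)).mp h1 P
  rw [mul_smul, inv_smul_eq_iff] at h2
  rw [h2]
  exact hτ₀


end Literature.NumberTheory.EllipticCurves.DeoRaySujatha2023

end
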